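import Literature.NumberTheory.Transcendental.KZCubeWords
import HarnessLib

/-!
# The cube calculus of end-regularised iterated integrals, II: transverse flatness (TF-Z)

For a CHART DIRECTION (`DirData`: regular letters `N_ℓ dt/(N_ℓ t + M_ℓ)` whose coefficients
depend on a transverse rider `Y`, together with transverse derivative data `N'_ℓ = Y∂_Y N_ℓ`,
`M'_ℓ = Y∂_Y M_ℓ`) we define the formal transverse derivative `δZ` of the word functions and of
the end-regularised series, prove its transport equation (`YDS_succ`), and establish
**transverse flatness at residues** (`DirData.tfz`): if the contracted connection is flat,
`[uΩ_u, YΩ_Y] = 0` at the rational points of the open box (`DirData.Flat`), then degree by degree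

  `δ𝐙_{n+1} = [t_⊥, 𝐙_n] + Σ_ℓ (t_ℓ 𝐙_n[e_ℓ] − 𝐙_n[e⁰_ℓ] t_ℓ) + [n = 0] Σ_ℓ ⟪ĕ_ℓ⟫ t_ℓ`

(`e_ℓ = Y∂_Y log(N_ℓ u + M_ℓ)`, `e⁰_ℓ` its value at `u = 0`, `ĕ_ℓ = (e_ℓ − e⁰_ℓ)/u`), by induction on
the degree through (S) and (O) of `KZCubeWords`; the junk terms are killed by the KILLING LEMMA
(`chi_famTerm_kill`): a pointwise rational identity among connection coefficients integrates to
zero (polynomial identities from vanishing on a box of rational points, `polyIdentity_box`).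
This is the formal (motivic) version of the variation of a regularised transport in a parameter
[IharaKanekoZagier2006, §3], [Furusho2010, §3], written so that only the Kontsevich–Zagier rules
[KontsevichZagier2001, §1.2] are used.

References: [cite: IharaKanekoZagier2006, §3]; [cite: KontsevichZagier2001, §1.2];
H. Furusho, *Pentagon and hexagon equations*, Ann. of Math. 171 (2010), §3.
-/

noncomputable section

open MeasureTheory Set MvPolynomial
open Literature.ModelTheory.ExponentialFields (IsSemialgebraic analyticOnNhd_aeval continuous_aeval_real)
open Literature.NumberTheory.Transcendental

namespace Literature.NumberTheory.Transcendental.KZ.Cube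

variable {M N : ℕ}

/-! ## The transport equation at the level of residues -/

section SeriesDK

open Shuffle NCSeries

variable {R : Type} [CommRing R] [Algebra ℚ R] {χ : KZ.FormalRep →+ R} (hrel : ∀ c ∈ KZ.relations, χ c = 0)
variable {ι : Type} [Fintype ι] [DecidableEq ι] {m k : ℕ}
variable {A : Type} [Ring A] [Algebra R A]
variable (c : ℚ) (hc : 0 ≤ c) (d : ι → Letter m) (hd : ∀ a, (d a).IsRegular c)

/-- The degree-`j` part `Σ_{|W| = j} 𝐙(ρ,π)(W) t_W` of the regularised `Z`-series read at residues
`t`. [cite: IharaKanekoZagier2006, §3] -/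
def ZS (j : ℕ) (t : ι → A) (o : ι) (ρ : RFun (m + k)) (π : MvPolynomial (Fin (m + k)) ℚ) (hπ : IsScale π) : A :=
  evalW j t (Zser (χ := χ) c hc d hd o ρ π hπ)

/-- The degree-`j` part of the regularised `D`-series read at residues `t`. [cite: IharaKanekoZagier2006, §3] -/
def DS (j : ℕ) (t : ι → A) (o : ι) (ρ : RFun (m + k)) (π : MvPolynomial (Fin (m + k)) ℚ) (hπ : IsScale π) : A :=
  evalW j t (Dser (χ := χ) c hc d hd o ρ π hπ)

/-- `ZS 0 = 0`. [folklore] -/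
@[simp] theorem ZS_zero (t : ι → A) (o : ι) (ρ : RFun (m + k)) (π : MvPolynomial (Fin (m + k)) ℚ) (hπ : IsScale π) :
    ZS (χ := χ) c hc d hd 0 t o ρ π hπ = 0 := by
  simp [ZS, Zser]

/-- `DS 0 = 0`. [folklore] -/
@[simp] theorem DS_zero (t : ι → A) (o : ι) (ρ : RFun (m + k)) (π : MvPolynomial (Fin (m + k)) ℚ) (hπ : IsScale π) :
    DS (χ := χ) c hc d hd 0 t o ρ π hπ = 0 := by
  simp [DS, Dser]

include hrel

/-- **(S) at residues**: `ZS_j(ρ,π) = DS_j(ρ⁺, π v)`. [folklore] -/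
theorem ZS_eq_DS (j : ℕ) (t : ι → A) (o : ι) (ρ : RFun (m + k)) (π : MvPolynomial (Fin (m + k)) ℚ) (hπ : IsScale π) :
    ZS (χ := χ) c hc d hd j t o ρ π hπ =
      DS (χ := χ) c hc d hd j t o (k := k + 1) ρ.lift (scaleMul π) (isScale_scaleMul hπ) := by
  classical
  unfold ZS DS
  congr 1
  funext W
  exact Zser_eq_Dser hrel c hc d hd o ρ π hπ W

/-- **(O) at residues** — the transport equation in degree `j + 1`:
`DS_{j+1}(ρ,π) = Σ_ℓ t_ℓ · ([j=0]⟪ρ last_ℓ⟫ + ZS_j(ρ c_ℓ, π)) − ([j=0]⟪ρ⟫ + ZS_j(ρ,π)) · t_o`.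
[cite: IharaKanekoZagier2006, §3] -/
theorem DS_succ (o : ι) (hdo : d o = Letter.inv) (j : ℕ) (t : ι → A) (ρ : RFun (m + (k + 1)))
    (π : MvPolynomial (Fin (m + (k + 1))) ℚ) (hπ : IsScale π) :
    DS (χ := χ) c hc d hd (j + 1) t o ρ π hπ =
      ∑ ℓ : ι, t ℓ * (if j = 0 then (ρ.mul (lastMult c hc (d ℓ) (hd ℓ) π hπ)).chi χ • (1 : A)
          else ZS (χ := χ) c hc d hd j t o (ρ.mul (headMult c hc (d ℓ) (hd ℓ) π hπ)) π hπ) -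
        (if j = 0 then ρ.chi χ • (1 : A) else ZS (χ := χ) c hc d hd j t o ρ π hπ) * t o := by
  -- split `Dser` into its head and gauge parts
  set headSer : NCSeries ι R := fun W => match W with
    | [] => 0
    | ℓ :: W₀ => if W₀ = [] then (ρ.mul (lastMult c hc (d ℓ) (hd ℓ) π hπ)).chi χ
        else Zser (χ := χ) c hc d hd o (ρ.mul (headMult c hc (d ℓ) (hd ℓ) π hπ)) π hπ W₀ with hheadSer
  set gaugeSer : NCSeries ι R := fun W => if W.getLast? = some o then
      (if W.dropLast = [] then ρ.chi χ else Zser (χ := χ) c hc d hd o ρ π hπ W.dropLast) else 0 with hgaugeSer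
  have hsplit : Dser (χ := χ) c hc d hd o ρ π hπ = headSer - gaugeSer := by
    funext W
    cases W with
    | nil => simp [Dser, hheadSer, hgaugeSer]
    | cons ℓ₀ W₀ =>
      rw [NCSeries.sub_apply, Dser_cons hrel c hc d hd o hdo ρ π hπ ℓ₀ W₀]
  rw [DS, hsplit, evalW_sub', evalW_succ, evalW_succ_snoc]
  congr 1
  · refine Finset.sum_congr rfl fun ℓ _ => ?_
    congr 1
    have : lderiv ℓ headSer = fun W₀ => if W₀ = [] then (ρ.mul (lastMult c hc (d ℓ) (hd ℓ) π hπ)).chi χ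
        else Zser (χ := χ) c hc d hd o (ρ.mul (headMult c hc (d ℓ) (hd ℓ) π hπ)) π hπ W₀ := by
      funext W₀; rfl
    rw [this, evalW_ite_nil]
    rfl
  · have hr : ∀ a : ι, (fun U : List ι => gaugeSer (U ++ [a])) =
        fun U => if a = o then (if U = [] then ρ.chi χ else Zser (χ := χ) c hc d hd o ρ π hπ U) else 0 := by
      intro a; funext U
      simp only [hgaugeSer, List.getLast?_concat, List.dropLast_concat, Option.some.injEq]
    simp only [hr]
    rw [Finset.sum_eq_single o (fun a _ ha => by simp [if_neg ha, evalW]) (fun h => (h (Finset.mem_univ _)).elim)]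
    simp only [if_true]
    rw [evalW_ite_nil]
    rfl

end SeriesDK


/-! ## Partial derivatives of regular rational functions: transfer and product rules -/

end Literature.NumberTheory.Transcendental.KZ.Cube

namespace Literature.NumberTheory.Transcendental.KZ

variable {M M' m n k N : ℕ}



namespace RFun

/-- **Transfer of a partial derivative**: if `T(y[i := t]) = S(y'[i' := t])` for `t ∈ [0,1]` at cube
points with `y i = y' i'`, then `∂ᵢT(y) = ∂_{i'}S(y')`. [folklore] -/
theorem fn_pd_eq_of_eqOn (T : RFun M) (S : RFun M') {y : Fin M → ℝ} (hy : y ∈ KZ.cube M)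
    {y' : Fin M' → ℝ} (hy' : y' ∈ KZ.cube M') (i : Fin M) (i' : Fin M') (hii : y i = y' i')
    (h : ∀ t ∈ Icc (0 : ℝ) 1, T.fn (Function.update y i t) = S.fn (Function.update y' i' t)) :
    (T.pd i).fn y = (S.pd i').fn y' := by
  have h1 := (T.hasDerivAt_fn_update hy i).hasDerivWithinAt (s := Icc 0 1)
  have h2 := (S.hasDerivAt_fn_update hy' i').hasDerivWithinAt (s := Icc 0 1)
  rw [← hii] at h2
  have hyi : y i ∈ Icc (0 : ℝ) 1 := ⟨(hy i).1, (hy i).2⟩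
  exact (uniqueDiffOn_Icc zero_lt_one _ hyi).eq_deriv _ h1 (h2.congr (fun t ht => h t ht) (h _ hyi))

/-- **Product rule** for partial derivatives at cube points. [folklore] -/
theorem fn_pd_mul (T S : RFun M) {y : Fin M → ℝ} (hy : y ∈ KZ.cube M) (i : Fin M) :
    ((T.mul S).pd i).fn y = (T.pd i).fn y * S.fn y + T.fn y * (S.pd i).fn y := by
  have h1 := (T.mul S).hasDerivAt_fn_update hy i
  have h2 := (T.hasDerivAt_fn_update hy i).mul (S.hasDerivAt_fn_update hy i)
  have hfun : (fun t => (T.mul S).fn (Function.update y i t)) =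
      fun t => T.fn (Function.update y i t) * S.fn (Function.update y i t) := by
    funext t; rw [RFun.fn_mul]
  rw [hfun] at h1
  have h3 := h1.unique h2
  simp only [Function.update_eq_self] at h3
  exact h3

/-- Partial derivative of a polynomial. [folklore] -/
@[simp] theorem fn_pd_poly (P : MvPolynomial (Fin M) ℚ) (i : Fin M) (y : Fin M → ℝ) :
    ((poly P).pd i).fn y = aeval y (pderiv i P) := by
  simp [pd, poly, fn]

/-- Partial derivative of a constant. [folklore] -/
@[simp] theorem fn_pd_const (c : ℚ) (i : Fin M) (y : Fin M → ℝ) : ((const c : RFun M).pd i).fn y = 0 := by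
  simp [const]

/-- Partial derivative of a sum at cube points. [folklore] -/
theorem fn_pd_add (T S : RFun M) {y : Fin M → ℝ} (hy : y ∈ KZ.cube M) (i : Fin M) :
    ((T.add S).pd i).fn y = (T.pd i).fn y + (S.pd i).fn y := by
  have h1 := (T.add S).hasDerivAt_fn_update hy i
  have h2 := (T.hasDerivAt_fn_update hy i).add (S.hasDerivAt_fn_update hy i)
  have hyi : y i ∈ Icc (0 : ℝ) 1 := ⟨(hy i).1, (hy i).2⟩
  refine (uniqueDiffOn_Icc zero_lt_one _ hyi).eq_deriv _ h1.hasDerivWithinAt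
    (h2.hasDerivWithinAt.congr (fun t ht => ?_) ?_)
  · exact RFun.fn_add (KZ.update_mem_cube hy _ ht.1 ht.2)
  · show (T.add S).fn (Function.update y i (y i)) = T.fn (Function.update y i (y i)) + S.fn (Function.update y i (y i))
    rw [Function.update_eq_self]; exact RFun.fn_add hy

end RFun

end Literature.NumberTheory.Transcendental.KZ

namespace Literature.NumberTheory.Transcendental.KZ.Cube

variable {M N : ℕ}

section PdRules

variable {M M' : ℕ}

end PdRules

/-! ## The transverse derivative `∂_Y` of word functions (Y = the last letter rider) -/

section TransverseDeriv

variable {R : Type} [CommRing R] [Algebra ℚ R] {χ : KZ.FormalRep →+ R} (hrel : ∀ c ∈ KZ.relations, χ c = 0)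
variable {m n k : ℕ}

/-- The index of the transverse rider `Y` (the last of `m + 1` letter riders) in the word layout. [folklore] -/
def iY (n m : ℕ) : Fin ((n + (m + 1)) + 1) := Fin.castSucc (Fin.natAdd n (Fin.last m))

/-- The index of `Y` in a (riders, scale) function. [folklore] -/
def iYs (m : ℕ) : Fin ((m + 1) + 1) := Fin.castSucc (Fin.last m)

/-- The transverse derivative `∂_Y T` of a word-layout function over `m + 1` letter riders. [folklore] -/
def pdY (T : RFun ((n + (m + 1)) + 1)) : RFun ((n + (m + 1)) + 1) := T.pd (iY n m)

/-- Updating `Y` does not change the word coordinates. [folklore] -/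
theorem wX_update_iY (z : Fin ((n + (m + 1)) + 1) → ℝ) (t : ℝ) : wX (Function.update z (iY n m) t) = wX z := by
  funext j
  simp only [wX]
  rw [Function.update_of_ne]
  intro h
  have := congrArg Fin.val h
  simp [iY] at this
  omega

/-- Updating `Y` does not change the scale. [folklore] -/
theorem wScale_update_iY (z : Fin ((n + (m + 1)) + 1) → ℝ) (t : ℝ) : wScale (Function.update z (iY n m) t) = wScale z := by
  simp only [wScale]
  rw [Function.update_of_ne]
  intro h
  have := congrArg Fin.val h
  simp [iY] at this

/-- Updating `Y` updates the last rider. [folklore] -/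
theorem wRider_update_iY (z : Fin ((n + (m + 1)) + 1) → ℝ) (t : ℝ) :
    wRider (Function.update z (iY n m) t) = Function.update (wRider z) (Fin.last m) t := by
  funext j
  simp only [wRider]
  by_cases hj : j = Fin.last m
  · subst hj; rw [Function.update_self]; exact Function.update_self _ _ _
  · have hne : (Fin.castSucc (Fin.natAdd n j) : Fin ((n + (m + 1)) + 1)) ≠ iY n m := by
      intro h
      apply hj
      have := congrArg Fin.val h
      simp [iY] at this
      exact Fin.ext (by simpa using this)
    rw [Function.update_of_ne hj, Function.update_of_ne hne]
    rfl

/-- `snoc` of an updated rider block. [folklore] -/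
theorem snoc_update_last (r : Fin (m + 1) → ℝ) (s t : ℝ) :
    (Fin.snoc (Function.update r (Fin.last m) t) s : Fin ((m + 1) + 1) → ℝ) =
      Function.update (Fin.snoc r s) (iYs m) t := by
  funext i
  induction i using Fin.lastCases with
  | last =>
    have hne : (Fin.last (m + 1) : Fin ((m + 1) + 1)) ≠ iYs m := by
      intro h; have := congrArg Fin.val h; simp [iYs] at this
    rw [Fin.snoc_last, Function.update_of_ne hne, Fin.snoc_last]
  | cast j =>
    rw [Fin.snoc_castSucc]
    by_cases hj : j = Fin.last m
    · subst hj
      rw [Function.update_self]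
      exact (Function.update_self (β := fun _ => ℝ) (iYs m) t (Fin.snoc r s : Fin ((m + 1) + 1) → ℝ)).symm
    · have hne : (Fin.castSucc j : Fin ((m + 1) + 1)) ≠ iYs m := fun h => hj (Fin.castSucc_injective _ h)
      rw [Function.update_of_ne hj, Function.update_of_ne hne, Fin.snoc_castSucc]

/-- The peeled point of a `Y`-update is the `Y`-update of the peeled point. [folklore] -/
theorem peelPt_update_iY (z : Fin (((n + 1) + (m + 1)) + 1) → ℝ) (t : ℝ) :
    peelPt (Function.update z (iY (n + 1) m) t) = Function.update (peelPt z) (iY n m) t := by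
  apply layout_ext
  · funext j; rw [wX_peelPt, wX_update_iY, wX_update_iY, wX_peelPt]
  · rw [wRider_peelPt, wRider_update_iY, wRider_update_iY, wRider_peelPt]
  · rw [wScale_peelPt, wScale_update_iY, wX_update_iY, wScale_update_iY, wScale_peelPt]

/-- The `Y`-coordinate of the peeled point. [folklore] -/
theorem peelPt_iY (z : Fin (((n + 1) + (m + 1)) + 1) → ℝ) : peelPt z (iY n m) = z (iY (n + 1) m) := by
  have h := congrFun (wRider_peelPt z) (Fin.last m)
  simpa [wRider, iY] using h

/-- **`∂_Y` of a peeling function peels**: if `T(z) = P(peelPt z)` on the cube then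
`(∂_Y T)(z) = (∂_Y P)(peelPt z)` on the cube. [folklore] -/
theorem fn_pdY_of_peel (T : RFun (((n + 1) + (m + 1)) + 1)) (P : RFun ((n + (m + 1)) + 1))
    (hpeel : ∀ z ∈ KZ.cube (((n + 1) + (m + 1)) + 1), T.fn z = P.fn (peelPt z))
    {z : Fin (((n + 1) + (m + 1)) + 1) → ℝ} (hz : z ∈ KZ.cube (((n + 1) + (m + 1)) + 1)) :
    (pdY T).fn z = (pdY P).fn (peelPt z) := by
  refine RFun.fn_pd_eq_of_eqOn T P hz (peelPt_mem hz) _ _ (peelPt_iY z).symm fun t ht => ?_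
  rw [hpeel _ (KZ.update_mem_cube hz _ ht.1 ht.2), peelPt_update_iY]

/-- **`∂_Y` of a scale-only function** is the scale-only function of `∂_Y`. [folklore] -/
theorem fn_pdY_of_scaleOnly (H : RFun ((m + 1) + 1)) (Hn : RFun ((n + (m + 1)) + 1))
    (hH : ∀ z, Hn.fn z = H.fn (Fin.snoc (wRider z) (wScale z)))
    {z : Fin ((n + (m + 1)) + 1) → ℝ} (hz : z ∈ KZ.cube ((n + (m + 1)) + 1)) :
    (pdY Hn).fn z = (H.pd (iYs m)).fn (Fin.snoc (wRider z) (wScale z)) := by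
  have hw : (Fin.snoc (wRider z) (wScale z) : Fin ((m + 1) + 1) → ℝ) ∈ KZ.cube ((m + 1) + 1) :=
    KZ.snoc_mem_cube_iff.2 ⟨wRider_mem hz, (hz _).1, (hz _).2⟩
  refine RFun.fn_pd_eq_of_eqOn Hn H hz hw _ _ ?_ fun t ht => ?_
  · show z (iY n m) = (Fin.snoc (wRider z) (wScale z) : Fin ((m + 1) + 1) → ℝ) (Fin.castSucc (Fin.last m))
    rw [Fin.snoc_castSucc]; rfl
  · rw [hH, wRider_update_iY, wScale_update_iY, snoc_update_last]

end TransverseDeriv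


/-! ## The transverse (O)-step: `∂_τ(τ ∂_Y Z_{a v'})` word by word, series, residues -/

section TransverseO

open Shuffle NCSeries

variable {R : Type} [CommRing R] [Algebra ℚ R] {χ : KZ.FormalRep →+ R} (hrel : ∀ c ∈ KZ.relations, χ c = 0)
variable {ι : Type} [Fintype ι] [DecidableEq ι] {m n k : ℕ}

include hrel in
omit [Algebra ℚ R] in
/-- A family term with no word coordinates and a scale-only word function is a multiplier class:
`⟪ρ · H[π]⟫ = ⟪ρ · H(e, π(e))⟫`. [folklore] -/
theorem chi_famTerm_zero_scaleOnly {m' : ℕ} (ρ : RFun (m' + k)) (H : RFun (m' + 1)) (Hn : RFun ((0 + m') + 1))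
    (hH : ∀ z, Hn.fn z = H.fn (Fin.snoc (wRider z) (wScale z))) (π : MvPolynomial (Fin (m' + k)) ℚ) (hπ : IsScale π) :
    (famTerm (n := 0) ρ Hn π hπ).chi χ = (ρ.mul (scaleFam H π hπ)).chi χ := by
  have h2 : (famTerm (n := 0) ρ Hn π hπ).chi χ = (famTerm (n := 0) (ρ.mul (scaleFam H π hπ)) (RFun.const 1) π hπ).chi χ := by
    refine RFun.chi_congr hrel fun y hy => ?_
    have hval : Hn.fn (famPt 0 π y) = (Hn.mul (RFun.const 1)).fn (famPt 0 π y) := by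
      rw [RFun.fn_mul, RFun.fn_const]; push_cast; ring
    rw [fn_famTerm, hval, ← fn_famTerm, fn_famTerm_mul_scaleOnly ρ H Hn hH]
  rw [h2]
  have h3 : ∀ y ∈ KZ.cube (0 + (m' + k)),
      (famTerm (n := 0) (ρ.mul (scaleFam H π hπ)) (RFun.const 1) π hπ).fn y = ((ρ.mul (scaleFam H π hπ)).pre 0).fn y :=
    fun y _ => by rw [fn_famTerm, RFun.fn_const, RFun.fn_pre]; push_cast; ring
  rw [RFun.chi_congr hrel h3, RFun.pre_eq_rename_liftN, RFun.chi_rename hrel, RFun.chi_liftN hrel]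

variable (c : ℚ) (hc : 0 ≤ c)

/-- The `Y`-derivative of the head factor read with the scale `π`: `(∂_Y c_ℓ)(c̄π; ·)`. [folklore] -/
def headMultY (ℓ : Letter (m + 1)) (hℓ : ℓ.IsRegular c) (π : MvPolynomial (Fin ((m + 1) + k)) ℚ) (hπ : IsScale π) :
    RFun ((m + 1) + k) :=
  scaleFam ((headS c hc ℓ hℓ).pd (iYs m)) π hπ

/-- The `Y`-derivative of the last factor read with the scale `π`. [folklore] -/
def lastMultY (ℓ : Letter (m + 1)) (hℓ : ℓ.IsRegular c) (π : MvPolynomial (Fin ((m + 1) + k)) ℚ) (hπ : IsScale π) :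
    RFun ((m + 1) + k) :=
  scaleFam ((lastS c hc ℓ hℓ).pd (iYs m)) π hπ

/-- The head factor of the invisible letter has zero `Y`-derivative. [folklore] -/
theorem fn_pd_headS_inv (h : (Letter.inv : Letter (m + 1)).IsRegular c) {w : Fin ((m + 1) + 1) → ℝ}
    (hw : w ∈ KZ.cube ((m + 1) + 1)) (i : Fin ((m + 1) + 1)) : ((headS c hc Letter.inv h).pd i).fn w = 0 := by
  have h1 := (headS c hc Letter.inv h).hasDerivAt_fn_update hw i
  have : (fun t : ℝ => (headS c hc Letter.inv h).fn (Function.update w i t)) = fun _ => 1 := by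
    funext t; rw [fn_headS, Letter.cR_inv]
  rw [this] at h1
  exact h1.unique (hasDerivAt_const _ _)

/-- The last factor of the invisible letter has zero `Y`-derivative. [folklore] -/
theorem fn_pd_lastS_inv (h : (Letter.inv : Letter (m + 1)).IsRegular c) {w : Fin ((m + 1) + 1) → ℝ}
    (hw : w ∈ KZ.cube ((m + 1) + 1)) (i : Fin ((m + 1) + 1)) : ((lastS c hc Letter.inv h).pd i).fn w = 0 := by
  have h1 := (lastS c hc Letter.inv h).hasDerivAt_fn_update hw i
  have : (fun t : ℝ => (lastS c hc Letter.inv h).fn (Function.update w i t)) = fun _ => 1 := by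
    funext t; rw [fn_lastS, Letter.lastR_inv]
  rw [this] at h1
  exact h1.unique (hasDerivAt_const _ _)

variable (d : ι → Letter (m + 1)) (hd : ∀ a, (d a).IsRegular c)

include hrel

omit [Algebra ℚ R] [Fintype ι] [DecidableEq ι] in
/-- **The transverse (O)-step for one word.** For `v'` non-empty:
`⟪ρ · ∂_τ(τ ∂_Y Z_{a v'})[π]⟫ = ⟪(ρ (∂_Y c_a)(c̄π)) · Z_{v'}[π]⟫ + ⟪(ρ c_a(c̄π)) · (∂_Y Z_{v'})[π]⟫`. [folklore] -/
theorem chi_famTerm_scaleDeriv_pdY_cons (a : ι) (v : List ι) (hv0 : v ≠ []) (ρ : RFun ((m + 1) + (k + 1)))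
    (π : MvPolynomial (Fin ((m + 1) + (k + 1))) ℚ) (hπ : IsScale π) :
    (famTerm ρ (scaleDeriv (pdY (Zw c hc d hd (a :: v)))) π hπ).chi χ =
      (famTerm (ρ.mul (headMultY c hc (d a) (hd a) π hπ)) (Zw c hc d hd v) π hπ).chi χ +
        (famTerm (ρ.mul (headMult c hc (d a) (hd a) π hπ)) (pdY (Zw c hc d hd v)) π hπ).chi χ := by
  have hpeel : ∀ z ∈ KZ.cube (((v.length + 1) + (m + 1)) + 1),
      (Zw c hc d hd (a :: v)).fn z = (peelF c hc d hd a v).fn (peelPt z) := fun z hz => fn_Zw_eq_peelF c hc d hd a v z hz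
  have hpeel' : ∀ z ∈ KZ.cube (((v.length + 1) + (m + 1)) + 1),
      (pdY (Zw c hc d hd (a :: v))).fn z = (pdY (peelF c hc d hd a v)).fn (peelPt z) := fun z hz =>
    fn_pdY_of_peel _ _ hpeel hz
  rw [chi_famTerm_scaleDeriv_of_peel hrel _ _ hpeel' ρ π hπ, headMultY, headMult,
    ← chi_famTerm_smulS hrel ρ ((headS c hc (d a) (hd a)).pd (iYs m)) (Zw c hc d hd v) π hπ,
    ← chi_famTerm_smulS hrel ρ (headS c hc (d a) (hd a)) (pdY (Zw c hc d hd v)) π hπ, ← RFun.chi_add hrel]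
  refine RFun.chi_congr hrel fun y hy => ?_
  have hz := famPt_mem (n := v.length) hπ hy
  rw [RFun.fn_add hy, fn_famTerm, fn_famTerm, fn_famTerm, peelF, if_neg hv0, pdY, RFun.fn_pd_mul _ _ hz, fn_smulS,
    fn_smulS, ← pdY, ← pdY, fn_pdY_of_scaleOnly (headS c hc (d a) (hd a)) (headF c hc (d a) (hd a))
      (fn_headF_eq c hc (d a) (hd a)) hz, fn_headF_eq]
  ring

omit [Algebra ℚ R] [Fintype ι] [DecidableEq ι] in
/-- **The transverse (O)-step for a one-letter word.** `⟪ρ · ∂_τ(τ ∂_Y Z_{[a]})[π]⟫ = ⟪ρ · (∂_Y last_a)(c̄π)⟫`.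
[folklore] -/
theorem chi_famTerm_scaleDeriv_pdY_singleton (a : ι) (ρ : RFun ((m + 1) + (k + 1)))
    (π : MvPolynomial (Fin ((m + 1) + (k + 1))) ℚ) (hπ : IsScale π) :
    (famTerm ρ (scaleDeriv (pdY (Zw c hc d hd [a]))) π hπ).chi χ =
      (ρ.mul (lastMultY c hc (d a) (hd a) π hπ)).chi χ := by
  have hpeel : ∀ z ∈ KZ.cube (((0 + 1) + (m + 1)) + 1),
      (Zw c hc d hd [a]).fn z = (peelF c hc d hd a []).fn (peelPt z) := fun z hz => fn_Zw_eq_peelF c hc d hd a [] z hz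
  have hpeel' : ∀ z ∈ KZ.cube (((0 + 1) + (m + 1)) + 1),
      (pdY (Zw c hc d hd [a])).fn z = (pdY (peelF c hc d hd a [])).fn (peelPt z) := fun z hz =>
    fn_pdY_of_peel _ _ hpeel hz
  rw [chi_famTerm_scaleDeriv_of_peel hrel _ _ hpeel' ρ π hπ]
  have h1 : (famTerm ρ (pdY (peelF c hc d hd a [])) π hπ).chi χ =
      (famTerm (n := 0) ρ (liftS ((lastS c hc (d a) (hd a)).pd (iYs m))) π hπ).chi χ := by
    refine RFun.chi_congr hrel fun y hy => ?_
    rw [fn_famTerm, fn_famTerm, peelF, if_pos rfl,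
      fn_pdY_of_scaleOnly (lastS c hc (d a) (hd a)) (lastF c hc (d a) (hd a)) (fn_lastF_eq c hc (d a) (hd a))
        (famPt_mem hπ hy), fn_liftS]
    rfl
  rw [h1]
  exact chi_famTerm_zero_scaleOnly hrel ρ _ _ (fn_liftS _) π hπ

omit hrel

/-- The `∂_Y Z`-coefficient of a word: `⟪ρ · (∂_Y Z_v)[π]⟫`. [folklore] -/
def yzcoef (ρ : RFun ((m + 1) + k)) (π : MvPolynomial (Fin ((m + 1) + k)) ℚ) (hπ : IsScale π) (v : List ι) : R :=
  (famTerm ρ (pdY (Zw c hc d hd v)) π hπ).chi χ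

/-- The `∂_τ(τ ∂_Y Z)`-coefficient of a word. [folklore] -/
def dycoef (ρ : RFun ((m + 1) + k)) (π : MvPolynomial (Fin ((m + 1) + k)) ℚ) (hπ : IsScale π) (v : List ι) : R :=
  (famTerm ρ (scaleDeriv (pdY (Zw c hc d hd v))) π hπ).chi χ

/-- The regularised `∂_Y Z`-series `(∂_Y 𝐙)(ρ,π)(W) = ⟨yzcoef, regEnd o W⟩` (`0` on `[]`). [folklore] -/
def YZser (o : ι) (ρ : RFun ((m + 1) + k)) (π : MvPolynomial (Fin ((m + 1) + k)) ℚ) (hπ : IsScale π) : NCSeries ι R :=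
  fun W => if W = [] then 0 else pair (yzcoef (χ := χ) c hc d hd ρ π hπ) (regEnd o W)

/-- The regularised `∂_τ(τ ∂_Y Z)`-series. [folklore] -/
def DYser (o : ι) (ρ : RFun ((m + 1) + k)) (π : MvPolynomial (Fin ((m + 1) + k)) ℚ) (hπ : IsScale π) : NCSeries ι R :=
  fun W => if W = [] then 0 else pair (dycoef (χ := χ) c hc d hd ρ π hπ) (regEnd o W)

include hrel

omit [Fintype ι] in
/-- **(S) for the transverse series**: `(∂_Y𝐙)(ρ,π) = (∂_Y𝐃)(ρ⁺, π v)`. [folklore] -/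
theorem YZser_eq_DYser (o : ι) (ρ : RFun ((m + 1) + k)) (π : MvPolynomial (Fin ((m + 1) + k)) ℚ) (hπ : IsScale π)
    (W : List ι) :
    YZser (χ := χ) c hc d hd o ρ π hπ W =
      DYser (χ := χ) c hc d hd o (k := k + 1) ρ.lift (scaleMul π) (isScale_scaleMul hπ) W := by
  simp only [YZser, DYser]
  split_ifs
  · rfl
  · exact pair_congr fun v _ => chi_famTerm_eq_scaleDeriv hrel ρ _ π hπ

omit [Algebra ℚ R] [Fintype ι] [DecidableEq ι] in
/-- A head factor of the invisible letter does not change the multiplier (transverse series). [folklore] -/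
theorem yzcoef_mul_headMult_inv (ρ : RFun ((m + 1) + (k + 1))) (π : MvPolynomial (Fin ((m + 1) + (k + 1))) ℚ)
    (hπ : IsScale π) {o : ι} (hdo : d o = Letter.inv) (v : List ι) :
    yzcoef (χ := χ) c hc d hd (ρ.mul (headMult c hc (d o) (hd o) π hπ)) π hπ v = yzcoef (χ := χ) c hc d hd ρ π hπ v := by
  refine RFun.chi_congr hrel fun y _ => ?_
  rw [fn_famTerm, fn_famTerm, RFun.fn_mul, headMult, fn_scaleFam, fn_headS]
  generalize hd o = h
  revert h
  rw [hdo]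
  intro h
  rw [Letter.cR_inv, mul_one]

omit [Algebra ℚ R] [Fintype ι] [DecidableEq ι] in
/-- The `Y`-derivative of the head factor of the invisible letter kills the coefficient. [folklore] -/
theorem zcoef_mul_headMultY_inv (ρ : RFun ((m + 1) + (k + 1))) (π : MvPolynomial (Fin ((m + 1) + (k + 1))) ℚ)
    (hπ : IsScale π) {o : ι} (hdo : d o = Letter.inv) (v : List ι) :
    zcoef (χ := χ) c hc d hd (ρ.mul (headMultY c hc (d o) (hd o) π hπ)) π hπ v = 0 := by
  refine RFun.chi_eq_zero hrel fun y hy => ?_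
  rw [fn_famTerm, RFun.fn_mul, headMultY, fn_scaleFam]
  generalize hd o = h
  revert h
  rw [hdo]
  intro h
  have hw : (Fin.snoc (fun j => (fun i => y (Fin.natAdd v.length i)) (Fin.castAdd (k + 1) j))
      (aeval (fun i => y (Fin.natAdd v.length i)) π) : Fin ((m + 1) + 1) → ℝ) ∈ KZ.cube ((m + 1) + 1) :=
    KZ.snoc_mem_cube_iff.2 ⟨fun j => hy _, (hπ _ (rider_mem_cube hy)).1, (hπ _ (rider_mem_cube hy)).2⟩
  rw [fn_pd_headS_inv c hc h hw, mul_zero, zero_mul]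

omit [Algebra ℚ R] [Fintype ι] [DecidableEq ι] in
/-- The `Y`-derivative of the last factor of the invisible letter kills the class. [folklore] -/
theorem chi_mul_lastMultY_inv (ρ : RFun ((m + 1) + (k + 1))) (π : MvPolynomial (Fin ((m + 1) + (k + 1))) ℚ)
    (hπ : IsScale π) {o : ι} (hdo : d o = Letter.inv) :
    (ρ.mul (lastMultY c hc (d o) (hd o) π hπ)).chi χ = 0 := by
  refine RFun.chi_eq_zero hrel fun y hy => ?_
  rw [RFun.fn_mul, lastMultY, fn_scaleFam]
  generalize hd o = h
  revert h
  rw [hdo]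
  intro h
  have hw : (Fin.snoc (fun j => y (Fin.castAdd (k + 1) j)) (aeval y π) : Fin ((m + 1) + 1) → ℝ) ∈ KZ.cube ((m + 1) + 1) :=
    KZ.snoc_mem_cube_iff.2 ⟨fun j => hy _, (hπ _ hy).1, (hπ _ hy).2⟩
  rw [fn_pd_lastS_inv c hc h hw, mul_zero]

omit [Fintype ι] in
/-- Pairing the transverse `D`-coefficients of `ℓ`-prefixed words against `regEnd o U`. [folklore] -/
theorem pair_dycoef_cons (o ℓ : ι) (ρ : RFun ((m + 1) + (k + 1))) (π : MvPolynomial (Fin ((m + 1) + (k + 1))) ℚ)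
    (hπ : IsScale π) (U : List ι) :
    pair (fun v => dycoef (χ := χ) c hc d hd ρ π hπ (ℓ :: v)) (regEnd o U) =
      if U = [] then (ρ.mul (lastMultY c hc (d ℓ) (hd ℓ) π hπ)).chi χ
      else Zser (χ := χ) c hc d hd o (ρ.mul (headMultY c hc (d ℓ) (hd ℓ) π hπ)) π hπ U +
        YZser (χ := χ) c hc d hd o (ρ.mul (headMult c hc (d ℓ) (hd ℓ) π hπ)) π hπ U := by
  by_cases hU : U = []
  · subst hU
    rw [if_pos rfl, regEnd_nil', pair_single, one_smul]
    exact chi_famTerm_scaleDeriv_pdY_singleton hrel c hc d hd ℓ ρ π hπ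
  · rw [if_neg hU, Zser, YZser, if_neg hU, if_neg hU, ← pair_add_fun']
    refine pair_congr fun v hv => ?_
    have hvne : v ≠ [] := by
      intro h
      have := length_of_mem_support_regEnd o U hv
      rw [h, List.length_nil] at this
      exact hU (List.length_eq_zero_iff.1 this.symm)
    exact chi_famTerm_scaleDeriv_pdY_cons hrel c hc d hd ℓ v hvne ρ π hπ

/-- **Transverse (O)**: for `W = ℓ₀ W₀`,
`(∂_Y𝐃)(ρ,π)(W) = [W₀=[]]⟪ρ ∂_Y last_{ℓ₀}⟫ + [W₀≠[]](𝐙(ρ ∂_Y c_{ℓ₀},π)(W₀) + (∂_Y𝐙)(ρ c_{ℓ₀},π)(W₀)) − [W ends in o](∂_Y𝐙)(ρ,π)(W∖last)`.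
[cite: IharaKanekoZagier2006, §3] -/
theorem DYser_cons (o : ι) (hdo : d o = Letter.inv) (ρ : RFun ((m + 1) + (k + 1)))
    (π : MvPolynomial (Fin ((m + 1) + (k + 1))) ℚ) (hπ : IsScale π) (ℓ₀ : ι) (W₀ : List ι) :
    DYser (χ := χ) c hc d hd o ρ π hπ (ℓ₀ :: W₀) =
      (if W₀ = [] then (ρ.mul (lastMultY c hc (d ℓ₀) (hd ℓ₀) π hπ)).chi χ
        else Zser (χ := χ) c hc d hd o (ρ.mul (headMultY c hc (d ℓ₀) (hd ℓ₀) π hπ)) π hπ W₀ +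
          YZser (χ := χ) c hc d hd o (ρ.mul (headMult c hc (d ℓ₀) (hd ℓ₀) π hπ)) π hπ W₀) -
      (if (ℓ₀ :: W₀).getLast? = some o then
        (if (ℓ₀ :: W₀).dropLast = [] then 0 else YZser (χ := χ) c hc d hd o ρ π hπ (ℓ₀ :: W₀).dropLast)
        else 0) := by
  have hW : (ℓ₀ :: W₀) ≠ [] := List.cons_ne_nil _ _
  have h0 : (regEnd o (ℓ₀ :: W₀)) [] = 0 := by
    by_contra h
    have := length_of_mem_support_regEnd o (ℓ₀ :: W₀) (Finsupp.mem_support_iff.2 h)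
    simp at this
  rw [DYser, if_neg hW, pair_eq_sum_tailAt _ _ h0]
  simp only [tailAt_regEnd, pair_sub', Finset.sum_sub_distrib]
  congr 1
  · rw [Finset.sum_eq_single ℓ₀ (fun ℓ _ hne => by rw [if_neg (by simpa using Ne.symm hne), pair_zero])
      (fun h => (h (Finset.mem_univ _)).elim), if_pos (by simp), List.tail_cons]
    exact pair_dycoef_cons hrel c hc d hd o ℓ₀ ρ π hπ W₀
  · rw [Finset.sum_eq_single o (fun ℓ _ hne => by rw [if_neg (fun h => hne h.1), pair_zero])
      (fun h => (h (Finset.mem_univ _)).elim)]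
    by_cases hlast : (ℓ₀ :: W₀).getLast? = some o
    · rw [if_pos ⟨rfl, hlast⟩, if_pos hlast, pair_dycoef_cons hrel c hc d hd o o ρ π hπ]
      split_ifs with hnil
      · exact chi_mul_lastMultY_inv hrel c hc d hd ρ π hπ hdo
      · simp only [Zser, YZser, if_neg hnil]
        rw [pair_congr fun v _ => zcoef_mul_headMultY_inv hrel c hc d hd ρ π hπ hdo v, pair_zero', zero_add]
        exact pair_congr fun v _ => yzcoef_mul_headMult_inv hrel c hc d hd ρ π hπ hdo v
    · rw [if_neg (fun h => hlast h.2), if_neg hlast, pair_zero]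

end TransverseO


/-! ## The peel substitution as an `RFun` operation -/

section PrePeel

variable {m n : ℕ}

/-- The polynomial map realising `peelPt`. [folklore] -/
def peelSubst (n m : ℕ) : Fin ((n + m) + 1) → MvPolynomial (Fin (((n + 1) + m) + 1)) ℚ :=
  Fin.lastCases (X (Fin.last ((n + 1) + m)) * X (Fin.castSucc (Fin.castAdd m (0 : Fin (n + 1)))))
    (Fin.addCases (fun j : Fin n => X (Fin.castSucc (Fin.castAdd m j.succ)))
      (fun j : Fin m => X (Fin.castSucc (Fin.natAdd (n + 1) j))))

/-- Evaluating the peel substitution gives the peeled point. [folklore] -/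
theorem aeval_peelSubst (z : Fin (((n + 1) + m) + 1) → ℝ) : (fun i => aeval z (peelSubst n m i)) = peelPt z := by
  funext i
  induction i using Fin.lastCases with
  | last => simp [peelSubst, peelPt, wScale, wX]
  | cast i =>
    simp only [peelSubst, peelPt, Fin.lastCases_castSucc, Fin.snoc_castSucc]
    induction i using Fin.addCases with
    | left j => simp [wX]
    | right j => simp [wRider]

/-- **Un-peeling**: the word-layout function `z ↦ P(peelPt z)` of one more word coordinate. [folklore] -/
def prePeel (P : RFun ((n + m) + 1)) : RFun (((n + 1) + m) + 1) :=
  P.subst (peelSubst n m) fun z hz => by rw [aeval_peelSubst]; exact peelPt_mem hz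

/-- Value of `prePeel`. [folklore] -/
theorem fn_prePeel (P : RFun ((n + m) + 1)) (z : Fin (((n + 1) + m) + 1) → ℝ) : (prePeel P).fn z = P.fn (peelPt z) := by
  rw [prePeel, RFun.fn_subst, aeval_peelSubst]

end PrePeel

/-! ## Chart-direction data: regular letters of one direction with transverse derivative data -/

section DirDataSec

variable {m n k : ℕ}

/-- Embedding rider polynomials into (riders, scale) polynomials. [folklore] -/
abbrev embS (P : MvPolynomial (Fin m) ℚ) : MvPolynomial (Fin (m + 1)) ℚ := MvPolynomial.rename Fin.castSucc P

/-- The scaled moving variable `u = c̄ τ` as a polynomial of (riders, scale). [folklore] -/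
def uS (c : ℚ) (m : ℕ) : MvPolynomial (Fin (m + 1)) ℚ := C c * X (Fin.last m)

/-- Evaluating an embedded rider polynomial. [folklore] -/
theorem aeval_embS (P : MvPolynomial (Fin m) ℚ) (w : Fin (m + 1) → ℝ) : aeval w (embS P) = aeval (Fin.init w) P := by
  rw [aeval_rename]; rfl

/-- Evaluating `uS`. [folklore] -/
theorem aeval_uS (c : ℚ) (w : Fin (m + 1) → ℝ) : aeval w (uS c m) = c * w (Fin.last m) := by
  simp [uS]

/-- **Direction data of a chart**: the bound `c̄` of the moving variable `u`, and for each divisor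
`ℓ` the letter `N_ℓ du/(N_ℓ u + M_ℓ)` (polynomials in the riders, regular on `[0, c̄]`) together with
the TRANSVERSE DERIVATIVE DATA `(N'_ℓ, M'_ℓ) = (δN_ℓ, δM_ℓ)` of a derivation `δ` of the riders
(for the pentagon charts: `f_ℓ = A + B u + C p + D u p`, `N = B + D p`, `M = A + C p`, `δ = p ∂_p`).
The axis `u = 0` is the extra letter `none` (form `du/u`, no transverse data).
[cite: KontsevichZagier2001, §1.1] -/
structure DirData (ι : Type) (m : ℕ) where
  /-- the bound of the moving variable -/
  c : ℚ
  /-- the bound is non-negative -/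
  hc : 0 ≤ c
  /-- the slope polynomials -/
  N : ι → MvPolynomial (Fin m) ℚ
  /-- the intercept polynomials -/
  M : ι → MvPolynomial (Fin m) ℚ
  /-- the transverse derivatives of the slopes -/
  N' : ι → MvPolynomial (Fin m) ℚ
  /-- the transverse derivatives of the intercepts -/
  M' : ι → MvPolynomial (Fin m) ℚ
  /-- every letter is regular on `[0, c̄]` -/
  reg : ∀ ℓ, (Letter.reg (N ℓ) (M ℓ) : Letter m).IsRegular c

namespace DirData

variable {ι : Type} (Δ : DirData ι m)

/-- The letter data over the alphabet `Option ι` (`none` = the axis). [folklore] -/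
def d : Option ι → Letter m := fun a => a.elim Letter.inv fun ℓ => Letter.reg (Δ.N ℓ) (Δ.M ℓ)

/-- All letters are regular. [folklore] -/
theorem hd : ∀ a, (Δ.d a).IsRegular Δ.c
  | none => trivial
  | some ℓ => Δ.reg ℓ

/-- The axis letter. [folklore] -/
@[simp] theorem d_none : Δ.d none = Letter.inv := rfl

/-- The divisor letters. [folklore] -/
@[simp] theorem d_some (ℓ : ι) : Δ.d (some ℓ) = Letter.reg (Δ.N ℓ) (Δ.M ℓ) := rfl

/-- The letter denominator does not vanish on the (riders, scale) cube. [folklore] -/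
theorem den_ne (ℓ : ι) {w : Fin (m + 1) → ℝ} (hw : w ∈ KZ.cube (m + 1)) :
    aeval (Fin.init w) (Δ.N ℓ) * (Δ.c * w (Fin.last m)) + aeval (Fin.init w) (Δ.M ℓ) ≠ 0 := by
  have hτ : 0 ≤ w (Fin.last m) ∧ w (Fin.last m) ≤ 1 := hw _
  have hc' : (0 : ℝ) ≤ Δ.c := by exact_mod_cast Δ.hc
  exact Δ.reg ℓ (Fin.init w) (fun i => hw _) _ (mul_nonneg hc' hτ.1) (by simpa using mul_le_mul_of_nonneg_left hτ.2 hc')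

/-- The intercept does not vanish on the rider cube (regularity at `u = 0`). [folklore] -/
theorem M_ne (ℓ : ι) {s : Fin m → ℝ} (hs : s ∈ KZ.cube m) : aeval s (Δ.M ℓ) ≠ 0 := by
  have h := Δ.reg ℓ s hs 0 le_rfl (by exact_mod_cast Δ.hc)
  simpa using h

/-- Evaluating the letter denominator polynomial. [folklore] -/
theorem aeval_den (ℓ : ι) (w : Fin (m + 1) → ℝ) :
    aeval w (embS (Δ.N ℓ) * uS Δ.c m + embS (Δ.M ℓ)) =
      aeval (Fin.init w) (Δ.N ℓ) * (Δ.c * w (Fin.last m)) + aeval (Fin.init w) (Δ.M ℓ) := by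
  rw [map_add, map_mul, aeval_embS, aeval_embS, aeval_uS]

/-- `δc_ℓ = u (N'M − N M')/(N u + M)²`, the transverse derivative of the head factor. [folklore] -/
def headSD (ℓ : ι) : RFun (m + 1) :=
  ⟨uS Δ.c m * (embS (Δ.N' ℓ) * embS (Δ.M ℓ) - embS (Δ.N ℓ) * embS (Δ.M' ℓ)),
    (embS (Δ.N ℓ) * uS Δ.c m + embS (Δ.M ℓ)) ^ 2, fun w hw => by
      rw [map_pow, aeval_den]; exact pow_ne_zero _ (Δ.den_ne ℓ hw)⟩

/-- `δ last_ℓ = (N'M − N M')/(N u + M)²`, the transverse derivative of the last factor. [folklore] -/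
def lastSD (ℓ : ι) : RFun (m + 1) :=
  ⟨embS (Δ.N' ℓ) * embS (Δ.M ℓ) - embS (Δ.N ℓ) * embS (Δ.M' ℓ),
    (embS (Δ.N ℓ) * uS Δ.c m + embS (Δ.M ℓ)) ^ 2, fun w hw => by
      rw [map_pow, aeval_den]; exact pow_ne_zero _ (Δ.den_ne ℓ hw)⟩

/-- `e_ℓ = δ log f_ℓ = (M' + N' u)/(M + N u)`, the transverse connection coefficient. [folklore] -/
def eS (ℓ : ι) : RFun (m + 1) :=
  ⟨embS (Δ.M' ℓ) + embS (Δ.N' ℓ) * uS Δ.c m, embS (Δ.N ℓ) * uS Δ.c m + embS (Δ.M ℓ), fun w hw => by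
      rw [aeval_den]; exact Δ.den_ne ℓ hw⟩

/-- `e⁰_ℓ = e_ℓ(u = 0) = M'/M`. [folklore] -/
def e0S (ℓ : ι) : RFun (m + 1) :=
  ⟨embS (Δ.M' ℓ), embS (Δ.M ℓ), fun w hw => by rw [aeval_embS]; exact Δ.M_ne ℓ fun i => hw _⟩

/-- `ĕ_ℓ = (e_ℓ(u) − e⁰_ℓ)/u = (N'M − M'N)/((M + N u) M)`. [folklore] -/
def ebrS (ℓ : ι) : RFun (m + 1) :=
  ⟨embS (Δ.N' ℓ) * embS (Δ.M ℓ) - embS (Δ.M' ℓ) * embS (Δ.N ℓ),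
    (embS (Δ.N ℓ) * uS Δ.c m + embS (Δ.M ℓ)) * embS (Δ.M ℓ), fun w hw => by
      rw [map_mul, aeval_den, aeval_embS]; exact mul_ne_zero (Δ.den_ne ℓ hw) (Δ.M_ne ℓ fun i => hw _)⟩

/-- The transverse derivative of the head factor, over the full alphabet (zero on the axis). [folklore] -/
def headSD' : Option ι → RFun (m + 1) := fun a => a.elim (RFun.const 0) Δ.headSD

/-- The transverse derivative of the last factor, over the full alphabet. [folklore] -/
def lastSD' : Option ι → RFun (m + 1) := fun a => a.elim (RFun.const 0) Δ.lastSD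

/-- The peeled form of the transverse derivative of a word function, given that of the tail. [folklore] -/
def peelFD (a : Option ι) (v : List (Option ι)) (S : RFun ((v.length + m) + 1)) : RFun ((v.length + m) + 1) :=
  if v = [] then liftS (Δ.lastSD' a)
  else ((liftS (Δ.headSD' a)).mul (Zw Δ.c Δ.hc Δ.d Δ.hd v)).add ((headF Δ.c Δ.hc (Δ.d a) (Δ.hd a)).mul S)

/-- **The formal transverse derivative `δZ_v`** of the word function, by the peeling recursion
`δZ_{a v'} = (δc_a) Z_{v'} + c_a δZ_{v'}` read through the peeled point. [folklore] -/
def ZD : (v : List (Option ι)) → RFun ((v.length + m) + 1)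
  | [] => RFun.const 0
  | a :: v => prePeel (Δ.peelFD a v (ZD v))

/-- `δZ_{a v'}` peels. [folklore] -/
theorem fn_ZD_cons (a : Option ι) (v : List (Option ι)) (z : Fin (((v.length + 1) + m) + 1) → ℝ) :
    (Δ.ZD (a :: v)).fn z = (Δ.peelFD a v (Δ.ZD v)).fn (peelPt z) := by
  rw [ZD, fn_prePeel]

end DirData

end DirDataSec

/-! ## The transverse (O)-step for the formal derivative, word by word, series and residues -/

section TransverseD

open Shuffle NCSeries

variable {R : Type} [CommRing R] [Algebra ℚ R] {χ : KZ.FormalRep →+ R} (hrel : ∀ c ∈ KZ.relations, χ c = 0)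
variable {ι : Type} [Fintype ι] [DecidableEq ι] {m n k : ℕ} (Δ : DirData ι m)

namespace DirData

/-- The transverse derivative of the head factor read with the scale `π`. [folklore] -/
def headMultD (a : Option ι) (π : MvPolynomial (Fin (m + k)) ℚ) (hπ : IsScale π) : RFun (m + k) :=
  scaleFam (Δ.headSD' a) π hπ

/-- The transverse derivative of the last factor read with the scale `π`. [folklore] -/
def lastMultD (a : Option ι) (π : MvPolynomial (Fin (m + k)) ℚ) (hπ : IsScale π) : RFun (m + k) :=
  scaleFam (Δ.lastSD' a) π hπ

include hrel

omit [Algebra ℚ R] [Fintype ι] [DecidableEq ι] in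
/-- A multiplier factor that is the zero constant kills a family term. [folklore] -/
theorem chi_famTerm_mul_scaleFam_const_zero (ρ : RFun (m + k)) (T : RFun ((n + m) + 1))
    (π : MvPolynomial (Fin (m + k)) ℚ) (hπ : IsScale π) :
    (famTerm (ρ.mul (scaleFam (RFun.const 0) π hπ)) T π hπ).chi χ = 0 :=
  RFun.chi_eq_zero hrel fun y _ => by
    rw [fn_famTerm, RFun.fn_mul, fn_scaleFam, RFun.fn_const]; push_cast; ring

omit [Algebra ℚ R] [Fintype ι] [DecidableEq ι] in
/-- A multiplier factor that is the zero constant kills a class. [folklore] -/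
theorem chi_mul_scaleFam_const_zero (ρ : RFun (m + k)) (π : MvPolynomial (Fin (m + k)) ℚ) (hπ : IsScale π) :
    (ρ.mul (scaleFam (RFun.const 0) π hπ)).chi χ = 0 :=
  RFun.chi_eq_zero hrel fun y _ => by
    rw [RFun.fn_mul, fn_scaleFam, RFun.fn_const]; push_cast; ring

omit [Algebra ℚ R] [Fintype ι] [DecidableEq ι] in
/-- The head factor of the axis letter is `1`: it does not change a family term. [folklore] -/
theorem chi_famTerm_mul_hM_none (ρ : RFun (m + k)) (T : RFun ((n + m) + 1))
    (π : MvPolynomial (Fin (m + k)) ℚ) (hπ : IsScale π) :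
    (famTerm (ρ.mul (headMult Δ.c Δ.hc (Δ.d none) (Δ.hd none) π hπ)) T π hπ).chi χ = (famTerm ρ T π hπ).chi χ :=
  RFun.chi_congr hrel fun y _ => by
    rw [fn_famTerm, fn_famTerm, RFun.fn_mul, headMult, fn_scaleFam, fn_headS]
    show _ * Letter.cR Letter.inv _ _ * _ = _
    rw [Letter.cR_inv, mul_one]

omit [Algebra ℚ R] [Fintype ι] [DecidableEq ι] in
/-- **The transverse (O)-step for one word (formal derivative).** For `v'` non-empty:
`⟪ρ · ∂_τ(τ δZ_{a v'})[π]⟫ = ⟪(ρ δc_a(c̄π)) · Z_{v'}[π]⟫ + ⟪(ρ c_a(c̄π)) · δZ_{v'}[π]⟫`. [folklore] -/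
theorem chi_famTerm_scaleDeriv_ZD_cons (a : Option ι) (v : List (Option ι)) (hv0 : v ≠ []) (ρ : RFun (m + (k + 1)))
    (π : MvPolynomial (Fin (m + (k + 1))) ℚ) (hπ : IsScale π) :
    (famTerm ρ (scaleDeriv (Δ.ZD (a :: v))) π hπ).chi χ =
      (famTerm (ρ.mul (Δ.headMultD a π hπ)) (Zw Δ.c Δ.hc Δ.d Δ.hd v) π hπ).chi χ +
        (famTerm (ρ.mul (headMult Δ.c Δ.hc (Δ.d a) (Δ.hd a) π hπ)) (Δ.ZD v) π hπ).chi χ := by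
  have hpeel : ∀ z ∈ KZ.cube (((v.length + 1) + m) + 1),
      (Δ.ZD (a :: v)).fn z = (Δ.peelFD a v (Δ.ZD v)).fn (peelPt z) := fun z _ => Δ.fn_ZD_cons a v z
  rw [chi_famTerm_scaleDeriv_of_peel hrel _ _ hpeel ρ π hπ, ← RFun.chi_add hrel]
  refine RFun.chi_congr hrel fun y hy => ?_
  have hz := famPt_mem (n := v.length) hπ hy
  have h1 : (famTerm (ρ.mul (Δ.headMultD a π hπ)) (Zw Δ.c Δ.hc Δ.d Δ.hd v) π hπ).fn y =
      (ρ.fn fun i => y (Fin.natAdd v.length i)) *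
        ((liftS (Δ.headSD' a)).fn (famPt v.length π y) * (Zw Δ.c Δ.hc Δ.d Δ.hd v).fn (famPt v.length π y)) := by
    rw [headMultD, ← fn_famTerm_mul_scaleOnly ρ (Δ.headSD' a) (liftS (Δ.headSD' a)) (fn_liftS _)
      (Zw Δ.c Δ.hc Δ.d Δ.hd v) π hπ y, fn_famTerm, RFun.fn_mul]
  have h2 : (famTerm (ρ.mul (headMult Δ.c Δ.hc (Δ.d a) (Δ.hd a) π hπ)) (Δ.ZD v) π hπ).fn y =
      (ρ.fn fun i => y (Fin.natAdd v.length i)) *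
        ((headF Δ.c Δ.hc (Δ.d a) (Δ.hd a)).fn (famPt v.length π y) * (Δ.ZD v).fn (famPt v.length π y)) := by
    rw [headMult, ← fn_famTerm_mul_scaleOnly ρ (headS Δ.c Δ.hc (Δ.d a) (Δ.hd a)) (headF Δ.c Δ.hc (Δ.d a) (Δ.hd a))
      (fn_headF_eq Δ.c Δ.hc (Δ.d a) (Δ.hd a)) (Δ.ZD v) π hπ y, fn_famTerm, RFun.fn_mul]
  rw [RFun.fn_add hy, h1, h2, fn_famTerm, DirData.peelFD, if_neg hv0, RFun.fn_add hz, RFun.fn_mul, RFun.fn_mul]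
  ring

omit [Algebra ℚ R] [Fintype ι] [DecidableEq ι] in
/-- **The transverse (O)-step for a one-letter word (formal derivative).**
`⟪ρ · ∂_τ(τ δZ_{[a]})[π]⟫ = ⟪ρ · δlast_a(c̄π)⟫`. [folklore] -/
theorem chi_famTerm_scaleDeriv_ZD_singleton (a : Option ι) (ρ : RFun (m + (k + 1)))
    (π : MvPolynomial (Fin (m + (k + 1))) ℚ) (hπ : IsScale π) :
    (famTerm ρ (scaleDeriv (Δ.ZD [a])) π hπ).chi χ = (ρ.mul (Δ.lastMultD a π hπ)).chi χ := by
  have hpeel : ∀ z ∈ KZ.cube (((0 + 1) + m) + 1),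
      (Δ.ZD [a]).fn z = (Δ.peelFD a [] (Δ.ZD [])).fn (peelPt z) := fun z _ => Δ.fn_ZD_cons a [] z
  rw [chi_famTerm_scaleDeriv_of_peel hrel _ _ hpeel ρ π hπ]
  have h1 : (famTerm ρ (Δ.peelFD a [] (Δ.ZD [])) π hπ).chi χ =
      (famTerm (n := 0) ρ (liftS (Δ.lastSD' a)) π hπ).chi χ := by
    refine RFun.chi_congr hrel fun y hy => ?_
    rw [fn_famTerm, fn_famTerm, DirData.peelFD, if_pos rfl]
    rfl
  rw [h1]
  exact chi_famTerm_zero_scaleOnly hrel ρ _ _ (fn_liftS _) π hπ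

omit hrel

/-- The `δZ`-coefficient of a word: `⟪ρ · δZ_v[π]⟫`. [folklore] -/
def ycoef (ρ : RFun (m + k)) (π : MvPolynomial (Fin (m + k)) ℚ) (hπ : IsScale π) (v : List (Option ι)) : R :=
  (famTerm ρ (Δ.ZD v) π hπ).chi χ

/-- The `∂_τ(τ δZ)`-coefficient of a word. [folklore] -/
def ydcoef (ρ : RFun (m + k)) (π : MvPolynomial (Fin (m + k)) ℚ) (hπ : IsScale π) (v : List (Option ι)) : R :=
  (famTerm ρ (scaleDeriv (Δ.ZD v)) π hπ).chi χ

/-- The regularised `δZ`-series `(δ𝐙)(ρ,π)(W) = ⟨ycoef, regEnd none W⟩` (`0` on `[]`). [folklore] -/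
def Yser (ρ : RFun (m + k)) (π : MvPolynomial (Fin (m + k)) ℚ) (hπ : IsScale π) : NCSeries (Option ι) R :=
  fun W => if W = [] then 0 else pair (Δ.ycoef (χ := χ) ρ π hπ) (regEnd none W)

/-- The regularised `∂_τ(τ δZ)`-series. [folklore] -/
def YDser (ρ : RFun (m + k)) (π : MvPolynomial (Fin (m + k)) ℚ) (hπ : IsScale π) : NCSeries (Option ι) R :=
  fun W => if W = [] then 0 else pair (Δ.ydcoef (χ := χ) ρ π hπ) (regEnd none W)

include hrel

omit [Fintype ι] in
/-- **(S) for the transverse series**: `(δ𝐙)(ρ,π) = (δ𝐃)(ρ⁺, π v)`. [folklore] -/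
theorem Yser_eq_YDser (ρ : RFun (m + k)) (π : MvPolynomial (Fin (m + k)) ℚ) (hπ : IsScale π) (W : List (Option ι)) :
    Δ.Yser (χ := χ) ρ π hπ W = Δ.YDser (χ := χ) (k := k + 1) ρ.lift (scaleMul π) (isScale_scaleMul hπ) W := by
  simp only [Yser, YDser]
  split_ifs
  · rfl
  · exact pair_congr fun v _ => chi_famTerm_eq_scaleDeriv hrel ρ _ π hπ

omit [Algebra ℚ R] [Fintype ι] [DecidableEq ι] in
/-- The transverse derivative of the head factor of the axis letter kills the `Z`-coefficient. [folklore] -/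
theorem zcoef_mul_headMultD_none (ρ : RFun (m + k)) (π : MvPolynomial (Fin (m + k)) ℚ) (hπ : IsScale π)
    (v : List (Option ι)) :
    zcoef (χ := χ) Δ.c Δ.hc Δ.d Δ.hd (ρ.mul (Δ.headMultD none π hπ)) π hπ v = 0 :=
  chi_famTerm_mul_scaleFam_const_zero hrel ρ _ π hπ

omit [Algebra ℚ R] [Fintype ι] [DecidableEq ι] in
/-- The head factor of the axis letter does not change the `δZ`-coefficient. [folklore] -/
theorem ycoef_mul_headMult_none (ρ : RFun (m + k)) (π : MvPolynomial (Fin (m + k)) ℚ) (hπ : IsScale π)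
    (v : List (Option ι)) :
    Δ.ycoef (χ := χ) (ρ.mul (headMult Δ.c Δ.hc (Δ.d none) (Δ.hd none) π hπ)) π hπ v = Δ.ycoef (χ := χ) ρ π hπ v :=
  Δ.chi_famTerm_mul_hM_none hrel ρ _ π hπ

omit [Fintype ι] in
/-- Pairing the transverse `D`-coefficients of `a`-prefixed words against `regEnd none U`. [folklore] -/
theorem pair_ydcoef_cons (a : Option ι) (ρ : RFun (m + (k + 1))) (π : MvPolynomial (Fin (m + (k + 1))) ℚ)
    (hπ : IsScale π) (U : List (Option ι)) :
    pair (fun v => Δ.ydcoef (χ := χ) ρ π hπ (a :: v)) (regEnd none U) =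
      if U = [] then (ρ.mul (Δ.lastMultD a π hπ)).chi χ
      else Zser (χ := χ) Δ.c Δ.hc Δ.d Δ.hd none (ρ.mul (Δ.headMultD a π hπ)) π hπ U + Δ.Yser (χ := χ) (ρ.mul (headMult Δ.c Δ.hc (Δ.d a) (Δ.hd a) π hπ)) π hπ U := by
  by_cases hU : U = []
  · subst hU
    rw [if_pos rfl, regEnd_nil', pair_single, one_smul]
    exact Δ.chi_famTerm_scaleDeriv_ZD_singleton hrel a ρ π hπ
  · rw [if_neg hU, Zser, Yser, if_neg hU, if_neg hU, ← pair_add_fun']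
    refine pair_congr fun v hv => ?_
    have hvne : v ≠ [] := by
      intro h
      have := length_of_mem_support_regEnd none U hv
      rw [h, List.length_nil] at this
      exact hU (List.length_eq_zero_iff.1 this.symm)
    exact Δ.chi_famTerm_scaleDeriv_ZD_cons hrel a v hvne ρ π hπ

/-- **Transverse (O)** for the formal derivative series: for `W = a W₀`,
`(δ𝐃)(ρ,π)(W) = [W₀=[]]⟪ρ δlast_a⟫ + [W₀≠[]](𝐙(ρ δc_a,π)(W₀) + (δ𝐙)(ρ c_a,π)(W₀)) − [W ends in the axis](δ𝐙)(ρ,π)(W∖last)`.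
[cite: IharaKanekoZagier2006, §3] -/
theorem YDser_cons (ρ : RFun (m + (k + 1))) (π : MvPolynomial (Fin (m + (k + 1))) ℚ) (hπ : IsScale π)
    (a : Option ι) (W₀ : List (Option ι)) :
    Δ.YDser (χ := χ) ρ π hπ (a :: W₀) =
      (if W₀ = [] then (ρ.mul (Δ.lastMultD a π hπ)).chi χ
        else Zser (χ := χ) Δ.c Δ.hc Δ.d Δ.hd none (ρ.mul (Δ.headMultD a π hπ)) π hπ W₀ + Δ.Yser (χ := χ) (ρ.mul (headMult Δ.c Δ.hc (Δ.d a) (Δ.hd a) π hπ)) π hπ W₀) -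
      (if (a :: W₀).getLast? = some none then
        (if (a :: W₀).dropLast = [] then 0 else Δ.Yser (χ := χ) ρ π hπ (a :: W₀).dropLast)
        else 0) := by
  have hW : (a :: W₀) ≠ [] := List.cons_ne_nil _ _
  have h0 : (regEnd none (a :: W₀)) [] = 0 := by
    by_contra h
    have := length_of_mem_support_regEnd none (a :: W₀) (Finsupp.mem_support_iff.2 h)
    simp at this
  rw [YDser, if_neg hW, pair_eq_sum_tailAt _ _ h0]
  simp only [tailAt_regEnd, pair_sub', Finset.sum_sub_distrib]
  congr 1
  · rw [Finset.sum_eq_single a (fun ℓ _ hne => by rw [if_neg (by simpa using Ne.symm hne), pair_zero])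
      (fun h => (h (Finset.mem_univ _)).elim), if_pos (by simp), List.tail_cons]
    exact Δ.pair_ydcoef_cons hrel a ρ π hπ W₀
  · rw [Finset.sum_eq_single none (fun ℓ _ hne => by rw [if_neg (fun h => hne h.1), pair_zero])
      (fun h => (h (Finset.mem_univ _)).elim)]
    by_cases hlast : (a :: W₀).getLast? = some none
    · rw [if_pos ⟨rfl, hlast⟩, if_pos hlast, Δ.pair_ydcoef_cons hrel none ρ π hπ]
      split_ifs with hnil
      · exact chi_mul_scaleFam_const_zero hrel ρ π hπ
      · simp only [Zser, Yser, if_neg hnil]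
        rw [pair_congr fun v _ => Δ.zcoef_mul_headMultD_none hrel ρ π hπ v, pair_zero', zero_add]
        exact pair_congr fun v _ => Δ.ycoef_mul_headMult_none hrel ρ π hπ v
    · rw [if_neg (fun h => hlast h.2), if_neg hlast, pair_zero]

/-! ### At residues -/

variable {A : Type} [Ring A] [Algebra R A]

omit hrel

/-- Degree-`j` part of the `δZ`-series at residues. [folklore] -/
def YS (j : ℕ) (t : Option ι → A) (ρ : RFun (m + k)) (π : MvPolynomial (Fin (m + k)) ℚ) (hπ : IsScale π) : A :=
  evalW j t (Δ.Yser (χ := χ) ρ π hπ)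

/-- Degree-`j` part of the `∂_τ(τ δZ)`-series at residues. [folklore] -/
def YDS (j : ℕ) (t : Option ι → A) (ρ : RFun (m + k)) (π : MvPolynomial (Fin (m + k)) ℚ) (hπ : IsScale π) : A :=
  evalW j t (Δ.YDser (χ := χ) ρ π hπ)

/-- `YS 0 = 0`. [folklore] -/
@[simp] theorem YS_zero (t : Option ι → A) (ρ : RFun (m + k)) (π : MvPolynomial (Fin (m + k)) ℚ) (hπ : IsScale π) :
    Δ.YS (χ := χ) 0 t ρ π hπ = 0 := by
  simp [YS, Yser]

/-- `YDS 0 = 0`. [folklore] -/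
@[simp] theorem YDS_zero (t : Option ι → A) (ρ : RFun (m + k)) (π : MvPolynomial (Fin (m + k)) ℚ) (hπ : IsScale π) :
    Δ.YDS (χ := χ) 0 t ρ π hπ = 0 := by
  simp [YDS, YDser]

include hrel

/-- **(S) at residues, transverse**: `YS_j(ρ,π) = YDS_j(ρ⁺, π v)`. [folklore] -/
theorem YS_eq_YDS (j : ℕ) (t : Option ι → A) (ρ : RFun (m + k)) (π : MvPolynomial (Fin (m + k)) ℚ) (hπ : IsScale π) :
    Δ.YS (χ := χ) j t ρ π hπ = Δ.YDS (χ := χ) j t (k := k + 1) ρ.lift (scaleMul π) (isScale_scaleMul hπ) := by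
  unfold YS YDS
  congr 1
  funext W
  exact Δ.Yser_eq_YDser hrel ρ π hπ W

/-- **Transverse (O) at residues** in degree `j + 1`:
`YDS_{j+1}(ρ,π) = Σ_a t_a ([j=0]⟪ρ δlast_a⟫ + ZS_j(ρ δc_a,π) + YS_j(ρ c_a,π)) − YS_j(ρ,π) t_axis`.
[cite: IharaKanekoZagier2006, §3] -/
theorem YDS_succ (j : ℕ) (t : Option ι → A) (ρ : RFun (m + (k + 1))) (π : MvPolynomial (Fin (m + (k + 1))) ℚ)
    (hπ : IsScale π) :
    Δ.YDS (χ := χ) (j + 1) t ρ π hπ =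
      ∑ a : Option ι, t a * ((if j = 0 then (ρ.mul (Δ.lastMultD a π hπ)).chi χ • (1 : A) else 0) +
          ZS (χ := χ) Δ.c Δ.hc Δ.d Δ.hd j t none (ρ.mul (Δ.headMultD a π hπ)) π hπ +
            Δ.YS (χ := χ) j t (ρ.mul (headMult Δ.c Δ.hc (Δ.d a) (Δ.hd a) π hπ)) π hπ) -
        Δ.YS (χ := χ) j t ρ π hπ * t none := by
  set headSer : NCSeries (Option ι) R := fun W => match W with
    | [] => 0
    | a :: W₀ => if W₀ = [] then (ρ.mul (Δ.lastMultD a π hπ)).chi χ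
        else Zser (χ := χ) Δ.c Δ.hc Δ.d Δ.hd none (ρ.mul (Δ.headMultD a π hπ)) π hπ W₀ + Δ.Yser (χ := χ) (ρ.mul (headMult Δ.c Δ.hc (Δ.d a) (Δ.hd a) π hπ)) π hπ W₀
    with hheadSer
  set gaugeSer : NCSeries (Option ι) R := fun W => if W.getLast? = some none then
      (if W.dropLast = [] then 0 else Δ.Yser (χ := χ) ρ π hπ W.dropLast) else 0 with hgaugeSer
  have hsplit : Δ.YDser (χ := χ) ρ π hπ = headSer - gaugeSer := by
    funext W
    cases W with
    | nil => simp [YDser, hheadSer, hgaugeSer]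
    | cons a W₀ => rw [NCSeries.sub_apply, Δ.YDser_cons hrel ρ π hπ a W₀]
  rw [YDS, hsplit, evalW_sub', evalW_succ, evalW_succ_snoc]
  congr 1
  · refine Finset.sum_congr rfl fun a _ => ?_
    congr 1
    have : lderiv a headSer = fun W₀ => if W₀ = [] then (ρ.mul (Δ.lastMultD a π hπ)).chi χ
        else (Zser (χ := χ) Δ.c Δ.hc Δ.d Δ.hd none (ρ.mul (Δ.headMultD a π hπ)) π hπ + Δ.Yser (χ := χ) (ρ.mul (headMult Δ.c Δ.hc (Δ.d a) (Δ.hd a) π hπ)) π hπ) W₀ := by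
      funext W₀; rfl
    rw [this, evalW_ite_nil]
    split_ifs with hj
    · subst hj
      simp only [ZS_zero, YS_zero, add_zero]
    · rw [zero_add, evalW_add]; rfl
  · have hr : ∀ a : Option ι, (fun U : List (Option ι) => gaugeSer (U ++ [a])) =
        fun U => if a = none then (if U = [] then (0 : R) else Δ.Yser (χ := χ) ρ π hπ U) else 0 := by
      intro a; funext U
      simp only [hgaugeSer, List.getLast?_concat, List.dropLast_concat, Option.some.injEq]
    simp only [hr]
    rw [Finset.sum_eq_single none (fun a _ ha => by simp [if_neg ha, evalW]) (fun h => (h (Finset.mem_univ _)).elim)]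
    simp only [if_true]
    rw [evalW_ite_nil]
    split_ifs with hj
    · subst hj; simp
    · rfl

end DirData

end TransverseD


/-! ## Killing junk terms: pointwise identities of connection coefficients integrate to zero -/

end Literature.NumberTheory.Transcendental.KZ.Cube

namespace Literature.NumberTheory.Transcendental.KZ

variable {M M' m n k N : ℕ}


open MvPolynomial in
/-- Evaluating a rational polynomial at a rational point, read in `ℝ`. [folklore] -/
theorem aeval_ratCast {M : ℕ} (w : Fin M → ℚ) (P : MvPolynomial (Fin M) ℚ) :
    aeval (fun i => (w i : ℝ)) P = ((MvPolynomial.eval w P : ℚ) : ℝ) := by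
  rw [MvPolynomial.aeval_def, ← MvPolynomial.eval_map,
    show (fun i => (w i : ℝ)) = (algebraMap ℚ ℝ) ∘ w from rfl]
  exact (MvPolynomial.map_eval (algebraMap ℚ ℝ) w P).symm

/-- **Polynomial identity principle with module coefficients on the open unit box**: if
`Σᵢ Pᵢ(x) • vᵢ = 0` at every rational point of `(0,1)^M` then every coefficient combination
`Σᵢ coeff_μ(Pᵢ) • vᵢ` vanishes. [folklore] -/
theorem polyIdentity_box (V : Type) [AddCommGroup V] [Module ℚ V] {κ : Type} [Fintype κ] {M : ℕ}
    (P : κ → MvPolynomial (Fin M) ℚ) (v : κ → V)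
    (h : ∀ x : Fin M → ℚ, (∀ i, 0 < x i ∧ x i < 1) → ∑ i, (MvPolynomial.eval x (P i)) • v i = 0) :
    ∀ μ : Fin M →₀ ℕ, ∑ i, (MvPolynomial.coeff μ (P i)) • v i = 0 := by
  intro μ
  refine (Module.forall_dual_apply_eq_zero_iff ℚ _).mp fun φ => ?_
  have hQ : (∑ i, φ (v i) • P i) = 0 := by
    refine MvPolynomial.funext_set (p := ∑ i, φ (v i) • P i) (q := 0) (fun _ => Set.Ioo (0 : ℚ) 1)
      (fun _ => Set.Ioo_infinite zero_lt_one) fun x hx => ?_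
    have hx' : ∀ i, 0 < x i ∧ x i < 1 := fun i => hx i (Set.mem_univ _)
    have := congrArg φ (h x hx')
    rw [map_zero, map_sum] at this
    rw [map_zero, map_sum, ← this]
    refine Finset.sum_congr rfl fun i _ => ?_
    rw [LinearMap.map_smul, smul_eq_mul, MvPolynomial.smul_eval, mul_comm]
  have := congrArg (MvPolynomial.coeff μ) hQ
  rw [MvPolynomial.coeff_sum, MvPolynomial.coeff_zero] at this
  rw [map_sum, ← this]
  refine Finset.sum_congr rfl fun i _ => ?_
  rw [LinearMap.map_smul, MvPolynomial.coeff_smul, smul_eq_mul, smul_eq_mul, mul_comm]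

namespace RFun

variable {M : ℕ}

/-- The value of a regular rational function at a rational point. [folklore] -/
def evalQ (g : RFun M) (w : Fin M → ℚ) : ℚ := MvPolynomial.eval w g.num / MvPolynomial.eval w g.den

/-- The real value at a rational point is the rational value. [folklore] -/
theorem fn_ratCast (g : RFun M) (w : Fin M → ℚ) : g.fn (fun i => (w i : ℝ)) = (g.evalQ w : ℝ) := by
  rw [fn, evalQ, aeval_ratCast, aeval_ratCast]; push_cast; rfl

/-- The denominator does not vanish at rational points of the cube. [folklore] -/
theorem eval_den_ne (g : RFun M) {w : Fin M → ℚ} (hw : ∀ i, 0 ≤ w i ∧ w i ≤ 1) : MvPolynomial.eval w g.den ≠ 0 := by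
  intro h
  apply g.den_ne (fun i => (w i : ℝ))
    (fun i => ⟨show (0 : ℝ) ≤ (w i : ℝ) by exact_mod_cast (hw i).1, show (w i : ℝ) ≤ 1 by exact_mod_cast (hw i).2⟩)
  rw [aeval_ratCast, h]; simp

end RFun

end Literature.NumberTheory.Transcendental.KZ

namespace Literature.NumberTheory.Transcendental.KZ.Cube

variable {M N : ℕ}

section Killing


variable {R : Type} [CommRing R] [Algebra ℚ R] {χ : KZ.FormalRep →+ R} (hrel : ∀ c ∈ KZ.relations, χ c = 0)

include hrel in
/-- **`ℚ`-linearity of classes**: `⟪q · T⟫ = q ⟪T⟫` for a rational constant `q`. [folklore] -/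
theorem RFun.chi_const_mul {M : ℕ} (q : ℚ) (T : RFun M) :
    ((RFun.const q).mul T).chi χ = algebraMap ℚ R q * T.chi χ := by
  -- natural multiples
  have hnat : ∀ (n : ℕ) (S : RFun M), ((RFun.const (n : ℚ)).mul S).chi χ = algebraMap ℚ R n * S.chi χ := by
    intro n S
    induction n with
    | zero =>
      rw [Nat.cast_zero, map_zero, zero_mul]
      exact RFun.chi_eq_zero hrel fun x _ => by rw [RFun.fn_mul, RFun.fn_const]; push_cast; ring
    | succ n ih =>
      have h1 : ((RFun.const ((n + 1 : ℕ) : ℚ)).mul S).chi χ = (((RFun.const (n : ℚ)).mul S).add S).chi χ :=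
        RFun.chi_congr hrel fun x hx => by
          rw [RFun.fn_add hx, RFun.fn_mul, RFun.fn_mul, RFun.fn_const, RFun.fn_const]; push_cast; ring
      rw [h1, RFun.chi_add hrel, ih, Nat.cast_succ, map_add, map_one]; ring
  -- integer multiples
  have hint : ∀ (z : ℤ) (S : RFun M), ((RFun.const (z : ℚ)).mul S).chi χ = algebraMap ℚ R z * S.chi χ := by
    intro z S
    obtain ⟨n, rfl | rfl⟩ := Int.eq_nat_or_neg z
    · rw [Int.cast_natCast]; exact hnat n S
    · have h1 : ((RFun.const ((-(n : ℤ) : ℤ) : ℚ)).mul S).chi χ = ((RFun.const (n : ℚ)).mul S).neg.chi χ :=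
        RFun.chi_congr hrel fun x _ => by
          rw [RFun.fn_neg, RFun.fn_mul, RFun.fn_mul, RFun.fn_const, RFun.fn_const]; push_cast; ring
      rw [h1, RFun.chi_neg hrel, hnat, Int.cast_neg, Int.cast_natCast, map_neg]; ring
  -- rationals: clear the denominator
  have h1 : ((RFun.const (q.den : ℚ)).mul ((RFun.const q).mul T)).chi χ = ((RFun.const (q.num : ℚ)).mul T).chi χ :=
    RFun.chi_congr hrel fun x _ => by
      rw [RFun.fn_mul, RFun.fn_mul, RFun.fn_mul, RFun.fn_const, RFun.fn_const, RFun.fn_const, ← mul_assoc]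
      congr 1
      have := Rat.mul_den_eq_num q
      rw [mul_comm] at this
      exact_mod_cast this
  have h2 := hnat q.den ((RFun.const q).mul T)
  rw [h1, hint] at h2
  have hd : algebraMap ℚ R ((q.den : ℚ)⁻¹) * algebraMap ℚ R (q.den : ℚ) = 1 := by
    rw [← map_mul, inv_mul_cancel₀ (Nat.cast_ne_zero.2 q.den_pos.ne'), map_one]
  calc ((RFun.const q).mul T).chi χ
      = algebraMap ℚ R ((q.den : ℚ)⁻¹) * (algebraMap ℚ R (q.den : ℚ) * ((RFun.const q).mul T).chi χ) := by
        rw [← mul_assoc, hd, one_mul]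
    _ = algebraMap ℚ R ((q.den : ℚ)⁻¹) * (algebraMap ℚ R (q.num : ℚ) * T.chi χ) := by rw [h2]
    _ = algebraMap ℚ R q * T.chi χ := by
        rw [← mul_assoc, ← map_mul, inv_mul_eq_div, Rat.num_div_den]

variable {A : Type} [Ring A] [Algebra R A] [Module ℚ A]
variable (hcompat : ∀ (q : ℚ) (b : A), (algebraMap ℚ R q) • b = q • b)
variable {m n k : ℕ}

include hrel in
/-- A polynomial multiplier expands over its monomials inside a family term. [folklore] -/
theorem chi_famTerm_poly_expand (ρ : RFun (m + k)) (T : RFun ((n + m) + 1)) (π : MvPolynomial (Fin (m + k)) ℚ)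
    (hπ : IsScale π) (Pp : MvPolynomial (Fin (m + 1)) ℚ) (S : Finset (Fin (m + 1) →₀ ℕ)) (hS : Pp.support ⊆ S) :
    (famTerm (ρ.mul (scaleFam (RFun.poly Pp) π hπ)) T π hπ).chi χ =
      ∑ mo ∈ S, algebraMap ℚ R (MvPolynomial.coeff mo Pp) *
        (famTerm (ρ.mul (scaleFam (RFun.poly (MvPolynomial.monomial mo 1)) π hπ)) T π hπ).chi χ := by
  have hP : Pp = ∑ mo ∈ S, MvPolynomial.monomial mo (MvPolynomial.coeff mo Pp) := by
    conv_lhs => rw [MvPolynomial.as_sum Pp]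
    exact Finset.sum_subset hS fun mo _ hmo => by rw [MvPolynomial.notMem_support_iff.1 hmo, map_zero]
  rw [RFun.chi_sum hrel S (fun mo => (RFun.const (MvPolynomial.coeff mo Pp)).mul
      (famTerm (ρ.mul (scaleFam (RFun.poly (MvPolynomial.monomial mo 1)) π hπ)) T π hπ))
      (famTerm (ρ.mul (scaleFam (RFun.poly Pp) π hπ)) T π hπ)]
  · exact Finset.sum_congr rfl fun mo _ => RFun.chi_const_mul hrel _ _
  · intro y hy
    rw [fn_famTerm, RFun.fn_mul, fn_scaleFam, RFun.fn_poly]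
    conv_lhs => rw [hP]
    rw [map_sum, Finset.mul_sum, Finset.sum_mul]
    refine Finset.sum_congr rfl fun mo _ => ?_
    rw [RFun.fn_mul, RFun.fn_const, fn_famTerm, RFun.fn_mul, fn_scaleFam, RFun.fn_poly,
      MvPolynomial.aeval_monomial, MvPolynomial.aeval_monomial, map_one, one_mul]
    simp only [eq_ratCast]
    ring

include hrel hcompat in
/-- **Killing lemma.** If the (riders, scale) functions `μᵢ` and elements `Bᵢ ∈ A` satisfy
`Σᵢ μᵢ(w) Bᵢ = 0` at every rational point of the open unit box, then for every multiplier, word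
function and scale, `Σᵢ ⟪(ρ μᵢ[π]) · T[π]⟫ Bᵢ = 0`. (Clear denominators, pass to monomial
coefficients by the polynomial identity principle, and expand the classes over monomials.) [folklore] -/
theorem chi_famTerm_kill {κ : Type} [Fintype κ] [DecidableEq κ] (μ : κ → RFun (m + 1)) (B : κ → A)
    (hpt : ∀ w : Fin (m + 1) → ℚ, (∀ i, 0 < w i ∧ w i < 1) → ∑ i, (algebraMap ℚ R ((μ i).evalQ w)) • B i = 0)
    (ρ : RFun (m + k)) (T : RFun ((n + m) + 1)) (π : MvPolynomial (Fin (m + k)) ℚ) (hπ : IsScale π) :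
    ∑ i, (famTerm (ρ.mul (scaleFam (μ i) π hπ)) T π hπ).chi χ • B i = 0 := by
  set Qd : MvPolynomial (Fin (m + 1)) ℚ := ∏ i, (μ i).den with hQd
  set P : κ → MvPolynomial (Fin (m + 1)) ℚ := fun i => (μ i).num * ∏ j ∈ Finset.univ.erase i, (μ j).den with hPdef
  -- (1) coefficient identities of the cleared combination
  have hcoef : ∀ mo, ∑ i, (MvPolynomial.coeff mo (P i)) • B i = 0 := by
    refine polyIdentity_box A P B fun x hx => ?_
    have hx' : ∀ i, 0 ≤ x i ∧ x i ≤ 1 := fun i => ⟨(hx i).1.le, (hx i).2.le⟩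
    have hden : ∀ i, MvPolynomial.eval x (μ i).den ≠ 0 := fun i => (μ i).eval_den_ne hx'
    have hP : ∀ i, MvPolynomial.eval x (P i) = (μ i).evalQ x * MvPolynomial.eval x Qd := by
      intro i
      have hdi := hden i
      simp only [hPdef, hQd, RFun.evalQ, map_mul, map_prod]
      rw [← Finset.mul_prod_erase Finset.univ (fun j => MvPolynomial.eval x (μ j).den) (Finset.mem_univ i)]
      field_simp
    calc ∑ i, MvPolynomial.eval x (P i) • B i
        = ∑ i, (MvPolynomial.eval x Qd) • ((algebraMap ℚ R ((μ i).evalQ x)) • B i) := by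
          refine Finset.sum_congr rfl fun i _ => ?_
          rw [hP, hcompat, smul_smul, mul_comm]
      _ = (MvPolynomial.eval x Qd) • ∑ i, (algebraMap ℚ R ((μ i).evalQ x)) • B i := by rw [Finset.smul_sum]
      _ = 0 := by rw [hpt x hx, smul_zero]
  -- (2) the common denominator as a multiplier
  have hQne : ∀ w ∈ KZ.cube (m + 1), aeval w Qd ≠ 0 := fun w hw => by
    rw [hQd, map_prod]; exact Finset.prod_ne_zero_iff.2 fun i _ => (μ i).den_ne w hw
  set invQ : RFun (m + 1) := ⟨1, Qd, hQne⟩ with hinvQ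
  set ρ' : RFun (m + k) := ρ.mul (scaleFam invQ π hπ) with hρ'
  -- (3) each class as a polynomial-multiplier class
  have hterm : ∀ i, (famTerm (ρ.mul (scaleFam (μ i) π hπ)) T π hπ).chi χ =
      (famTerm (ρ'.mul (scaleFam (RFun.poly (P i)) π hπ)) T π hπ).chi χ := by
    intro i
    refine RFun.chi_congr hrel fun y hy => ?_
    rw [fn_famTerm, fn_famTerm, hρ', RFun.fn_mul, RFun.fn_mul, RFun.fn_mul, fn_scaleFam, fn_scaleFam, fn_scaleFam,
      RFun.fn_poly]
    set w : Fin (m + 1) → ℝ := Fin.snoc (fun j => (fun i => y (Fin.natAdd n i)) (Fin.castAdd k j))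
      (aeval (fun i => y (Fin.natAdd n i)) π) with hw
    have hwmem : w ∈ KZ.cube (m + 1) :=
      KZ.snoc_mem_cube_iff.2 ⟨fun j => hy _, (hπ _ (rider_mem_cube hy)).1, (hπ _ (rider_mem_cube hy)).2⟩
    have hden : ∀ j, aeval w (μ j).den ≠ 0 := fun j => (μ j).den_ne w hwmem
    have hval : (μ i).fn w * aeval w Qd = aeval w (P i) := by
      have hdi := hden i
      rw [RFun.fn_apply, hPdef, hQd]
      simp only [map_mul, map_prod]
      rw [← Finset.mul_prod_erase Finset.univ (fun j => aeval w (μ j).den) (Finset.mem_univ i)]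
      field_simp
    have hinv : invQ.fn w = 1 / aeval w Qd := by rw [RFun.fn_apply, hinvQ]; simp
    have hQ := hQne w hwmem
    rw [hinv, ← hval]
    field_simp
  -- (4) expand over monomials and sum
  set S : Finset (Fin (m + 1) →₀ ℕ) := Finset.univ.biUnion fun i => (P i).support with hSdef
  have hsub : ∀ i, (P i).support ⊆ S := fun i => Finset.subset_biUnion_of_mem (fun i => (P i).support) (Finset.mem_univ i)
  calc ∑ i, (famTerm (ρ.mul (scaleFam (μ i) π hπ)) T π hπ).chi χ • B i
      = ∑ i, ∑ mo ∈ S, (algebraMap ℚ R (MvPolynomial.coeff mo (P i)) *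
          (famTerm (ρ'.mul (scaleFam (RFun.poly (MvPolynomial.monomial mo 1)) π hπ)) T π hπ).chi χ) • B i := by
        refine Finset.sum_congr rfl fun i _ => ?_
        rw [hterm i, chi_famTerm_poly_expand hrel ρ' T π hπ (P i) S (hsub i), Finset.sum_smul]
    _ = ∑ mo ∈ S, (famTerm (ρ'.mul (scaleFam (RFun.poly (MvPolynomial.monomial mo 1)) π hπ)) T π hπ).chi χ •
          ∑ i, (MvPolynomial.coeff mo (P i)) • B i := by
        rw [Finset.sum_comm]
        refine Finset.sum_congr rfl fun mo _ => ?_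
        rw [Finset.smul_sum]
        refine Finset.sum_congr rfl fun i _ => ?_
        rw [mul_comm, ← smul_smul, hcompat]
    _ = 0 := by simp only [hcoef, smul_zero, Finset.sum_const_zero]

include hcompat in
/-- **Closure of pointwise identities**: if `Σᵢ μᵢ(w) Bᵢ = 0` on the rational points of the open
unit box then also at every rational point of the closed cube. [folklore] -/
theorem smul_sum_eq_zero_closure {M : ℕ} {κ : Type} [Fintype κ] [DecidableEq κ] (μ : κ → RFun M) (B : κ → A)
    (hpt : ∀ w : Fin M → ℚ, (∀ i, 0 < w i ∧ w i < 1) → ∑ i, (algebraMap ℚ R ((μ i).evalQ w)) • B i = 0)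
    {w : Fin M → ℚ} (hw : ∀ i, 0 ≤ w i ∧ w i ≤ 1) : ∑ i, (algebraMap ℚ R ((μ i).evalQ w)) • B i = 0 := by
  set Qd : MvPolynomial (Fin M) ℚ := ∏ i, (μ i).den with hQd
  set P : κ → MvPolynomial (Fin M) ℚ := fun i => (μ i).num * ∏ j ∈ Finset.univ.erase i, (μ j).den with hPdef
  have hP : ∀ (x : Fin M → ℚ), (∀ i, 0 ≤ x i ∧ x i ≤ 1) → ∀ i,
      MvPolynomial.eval x (P i) = (μ i).evalQ x * MvPolynomial.eval x Qd := by
    intro x hx i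
    have hden : ∀ i, MvPolynomial.eval x (μ i).den ≠ 0 := fun i => (μ i).eval_den_ne hx
    have hdi := hden i
    simp only [hPdef, hQd, RFun.evalQ, map_mul, map_prod]
    rw [← Finset.mul_prod_erase Finset.univ (fun j => MvPolynomial.eval x (μ j).den) (Finset.mem_univ i)]
    field_simp
  have hcoef : ∀ mo, ∑ i, (MvPolynomial.coeff mo (P i)) • B i = 0 := by
    refine polyIdentity_box A P B fun x hx => ?_
    have hx' : ∀ i, 0 ≤ x i ∧ x i ≤ 1 := fun i => ⟨(hx i).1.le, (hx i).2.le⟩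
    calc ∑ i, MvPolynomial.eval x (P i) • B i
        = ∑ i, (MvPolynomial.eval x Qd) • ((algebraMap ℚ R ((μ i).evalQ x)) • B i) := by
          refine Finset.sum_congr rfl fun i _ => ?_
          rw [hP x hx', hcompat, smul_smul, mul_comm]
      _ = (MvPolynomial.eval x Qd) • ∑ i, (algebraMap ℚ R ((μ i).evalQ x)) • B i := by rw [Finset.smul_sum]
      _ = 0 := by rw [hpt x hx, smul_zero]
  -- the cleared combination vanishes identically, in particular at `w`
  have hPw : ∑ i, (MvPolynomial.eval w (P i)) • B i = 0 := by
    have : ∀ i, P i = ∑ mo ∈ (P i).support, MvPolynomial.monomial mo (MvPolynomial.coeff mo (P i)) :=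
      fun i => MvPolynomial.as_sum (P i)
    set S : Finset (Fin M →₀ ℕ) := Finset.univ.biUnion fun i => (P i).support with hSdef
    have hsub : ∀ i, (P i).support ⊆ S :=
      fun i => Finset.subset_biUnion_of_mem (fun i => (P i).support) (Finset.mem_univ i)
    have hPS : ∀ i, P i = ∑ mo ∈ S, MvPolynomial.monomial mo (MvPolynomial.coeff mo (P i)) := fun i => by
      conv_lhs => rw [this i]
      exact Finset.sum_subset (hsub i) fun mo _ hmo => by rw [MvPolynomial.notMem_support_iff.1 hmo, map_zero]
    calc ∑ i, (MvPolynomial.eval w (P i)) • B i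
        = ∑ i, ∑ mo ∈ S, (MvPolynomial.eval w (MvPolynomial.monomial mo 1) * MvPolynomial.coeff mo (P i)) • B i := by
          refine Finset.sum_congr rfl fun i _ => ?_
          conv_lhs => rw [hPS i]
          rw [map_sum, Finset.sum_smul]
          refine Finset.sum_congr rfl fun mo _ => ?_
          congr 1
          rw [MvPolynomial.eval_monomial, MvPolynomial.eval_monomial, one_mul, mul_comm]
      _ = ∑ mo ∈ S, MvPolynomial.eval w (MvPolynomial.monomial mo 1) • ∑ i, (MvPolynomial.coeff mo (P i)) • B i := by
          rw [Finset.sum_comm]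
          refine Finset.sum_congr rfl fun mo _ => ?_
          rw [Finset.smul_sum]
          refine Finset.sum_congr rfl fun i _ => ?_
          rw [smul_smul]
      _ = 0 := by simp only [hcoef, smul_zero, Finset.sum_const_zero]
  -- divide by `Qd(w) ≠ 0`
  have hQw : MvPolynomial.eval w Qd ≠ 0 := by
    rw [hQd, map_prod]; exact Finset.prod_ne_zero_iff.2 fun i _ => (μ i).eval_den_ne hw
  have h2 : (MvPolynomial.eval w Qd) • ∑ i, (algebraMap ℚ R ((μ i).evalQ w)) • B i = 0 := by
    rw [Finset.smul_sum, ← hPw]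
    refine Finset.sum_congr rfl fun i _ => ?_
    rw [hP w hw, hcompat, smul_smul, mul_comm]
  have := congrArg (fun b => (MvPolynomial.eval w Qd)⁻¹ • b) h2
  simpa only [smul_smul, inv_mul_cancel₀ hQw, one_smul, smul_zero] using this

end Killing


/-! ## Values of the direction functions; closedness and boundary identities -/

section DirValues

variable {m k : ℕ} {ι : Type} (Δ : DirData ι m)

namespace DirData

/-- Real slope at a (riders, scale) point. [folklore] -/
abbrev Nr (ℓ : ι) (w : Fin (m + 1) → ℝ) : ℝ := aeval (Fin.init w) (Δ.N ℓ)
/-- Real intercept. [folklore] -/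
abbrev Mr (ℓ : ι) (w : Fin (m + 1) → ℝ) : ℝ := aeval (Fin.init w) (Δ.M ℓ)
/-- Real transverse derivative of the slope. [folklore] -/
abbrev N'r (ℓ : ι) (w : Fin (m + 1) → ℝ) : ℝ := aeval (Fin.init w) (Δ.N' ℓ)
/-- Real transverse derivative of the intercept. [folklore] -/
abbrev M'r (ℓ : ι) (w : Fin (m + 1) → ℝ) : ℝ := aeval (Fin.init w) (Δ.M' ℓ)
/-- Real moving variable `u = c̄ τ`. [folklore] -/
abbrev ur (w : Fin (m + 1) → ℝ) : ℝ := Δ.c * w (Fin.last m)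

/-- The letter denominator at a cube point. [folklore] -/
theorem denr_ne (ℓ : ι) {w : Fin (m + 1) → ℝ} (hw : w ∈ KZ.cube (m + 1)) : Δ.Nr ℓ w * Δ.ur w + Δ.Mr ℓ w ≠ 0 :=
  Δ.den_ne ℓ hw

/-- The intercept at a cube point. [folklore] -/
theorem Mr_ne (ℓ : ι) {w : Fin (m + 1) → ℝ} (hw : w ∈ KZ.cube (m + 1)) : Δ.Mr ℓ w ≠ 0 :=
  Δ.M_ne ℓ fun _ => hw _

/-- Value of the head factor of a divisor letter. [folklore] -/
theorem fn_headS_some (ℓ : ι) (w : Fin (m + 1) → ℝ) :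
    (headS Δ.c Δ.hc (Δ.d (some ℓ)) (Δ.hd (some ℓ))).fn w = Δ.Nr ℓ w * Δ.ur w / (Δ.Nr ℓ w * Δ.ur w + Δ.Mr ℓ w) := by
  rw [fn_headS]; rfl

/-- Value of the head factor of the axis letter. [folklore] -/
theorem fn_headS_none (w : Fin (m + 1) → ℝ) : (headS Δ.c Δ.hc (Δ.d none) (Δ.hd none)).fn w = 1 := by
  rw [fn_headS]; rfl

/-- Value of the last factor of a divisor letter. [folklore] -/
theorem fn_lastS_some (ℓ : ι) (w : Fin (m + 1) → ℝ) :
    (lastS Δ.c Δ.hc (Δ.d (some ℓ)) (Δ.hd (some ℓ))).fn w = Δ.Nr ℓ w / (Δ.Nr ℓ w * Δ.ur w + Δ.Mr ℓ w) := by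
  rw [fn_lastS]; rfl

/-- Value of the last factor of the axis letter. [folklore] -/
theorem fn_lastS_none (w : Fin (m + 1) → ℝ) : (lastS Δ.c Δ.hc (Δ.d none) (Δ.hd none)).fn w = 1 := by
  rw [fn_lastS]; rfl

/-- Value of `headSD`. [folklore] -/
theorem fn_headSD (ℓ : ι) (w : Fin (m + 1) → ℝ) :
    (Δ.headSD ℓ).fn w = Δ.ur w * (Δ.N'r ℓ w * Δ.Mr ℓ w - Δ.Nr ℓ w * Δ.M'r ℓ w) / (Δ.Nr ℓ w * Δ.ur w + Δ.Mr ℓ w) ^ 2 := by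
  rw [RFun.fn_apply, headSD]
  simp only [map_mul, map_sub, map_pow, Δ.aeval_den, aeval_uS, aeval_embS]

/-- Value of `lastSD`. [folklore] -/
theorem fn_lastSD (ℓ : ι) (w : Fin (m + 1) → ℝ) :
    (Δ.lastSD ℓ).fn w = (Δ.N'r ℓ w * Δ.Mr ℓ w - Δ.Nr ℓ w * Δ.M'r ℓ w) / (Δ.Nr ℓ w * Δ.ur w + Δ.Mr ℓ w) ^ 2 := by
  rw [RFun.fn_apply, lastSD]
  simp only [map_mul, map_sub, map_pow, Δ.aeval_den, aeval_embS]

/-- Value of `eS`. [folklore] -/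
theorem fn_eS (ℓ : ι) (w : Fin (m + 1) → ℝ) :
    (Δ.eS ℓ).fn w = (Δ.M'r ℓ w + Δ.N'r ℓ w * Δ.ur w) / (Δ.Nr ℓ w * Δ.ur w + Δ.Mr ℓ w) := by
  rw [RFun.fn_apply, eS]
  simp only [map_mul, map_add, Δ.aeval_den, aeval_uS, aeval_embS]

/-- Value of `e0S`. [folklore] -/
theorem fn_e0S (ℓ : ι) (w : Fin (m + 1) → ℝ) : (Δ.e0S ℓ).fn w = Δ.M'r ℓ w / Δ.Mr ℓ w := by
  rw [RFun.fn_apply, e0S]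
  simp only [aeval_embS]

/-- Value of `ebrS`. [folklore] -/
theorem fn_ebrS (ℓ : ι) (w : Fin (m + 1) → ℝ) :
    (Δ.ebrS ℓ).fn w = (Δ.N'r ℓ w * Δ.Mr ℓ w - Δ.M'r ℓ w * Δ.Nr ℓ w) / ((Δ.Nr ℓ w * Δ.ur w + Δ.Mr ℓ w) * Δ.Mr ℓ w) := by
  rw [RFun.fn_apply, ebrS]
  simp only [map_mul, map_sub, Δ.aeval_den, aeval_embS]

/-- The values along a scale fibre: the rider part does not change. [folklore] -/
theorem init_snoc_rider (w : Fin (m + 1) → ℝ) (τ : ℝ) : Fin.init (Fin.snoc (Fin.init w) τ : Fin (m + 1) → ℝ) = Fin.init w :=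
  Fin.init_snoc _ _

/-- **The Euler derivative of a (riders, scale) function from an explicit derivative along the scale.** [folklore] -/
theorem fn_thetaS_of_hasDerivAt (g : RFun (m + 1)) {w : Fin (m + 1) → ℝ} (hw : w ∈ KZ.cube (m + 1)) {D : ℝ}
    (hD : HasDerivAt (fun τ : ℝ => g.fn (Fin.snoc (Fin.init w) τ)) D (w (Fin.last m))) :
    (thetaS g).fn w = w (Fin.last m) * D := by
  have h1 := g.hasDerivAt_fn_snoc (x := Fin.init w) (fun i => hw _) (t := w (Fin.last m)) ⟨(hw _).1, (hw _).2⟩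
  rw [Fin.snoc_init_self] at h1
  rw [fn_thetaS, h1.unique hD]

/-- **Closedness**: `δc_ℓ = θ e_ℓ` (`∂_p ∂_u log f = ∂_u ∂_p log f`). [folklore] -/
theorem fn_headSD_eq_thetaS_eS (ℓ : ι) {w : Fin (m + 1) → ℝ} (hw : w ∈ KZ.cube (m + 1)) :
    (Δ.headSD ℓ).fn w = (thetaS (Δ.eS ℓ)).fn w := by
  set Nv := Δ.Nr ℓ w
  set Mv := Δ.Mr ℓ w
  set N'v := Δ.N'r ℓ w
  set M'v := Δ.M'r ℓ w
  have hden : Nv * Δ.ur w + Mv ≠ 0 := Δ.denr_ne ℓ hw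
  -- the function along the fibre
  have hfun : (fun τ : ℝ => (Δ.eS ℓ).fn (Fin.snoc (Fin.init w) τ)) =
      fun τ => (M'v + N'v * (Δ.c * τ)) / (Nv * (Δ.c * τ) + Mv) := by
    funext τ; rw [Δ.fn_eS]; simp [Nr, Mr, N'r, M'r, ur, Fin.init_snoc, Fin.snoc_last, Nv, Mv, N'v, M'v]
  have hD : HasDerivAt (fun τ : ℝ => (M'v + N'v * (Δ.c * τ)) / (Nv * (Δ.c * τ) + Mv))
      (((N'v * Δ.c) * (Nv * (Δ.c * w (Fin.last m)) + Mv) - (M'v + N'v * (Δ.c * w (Fin.last m))) * (Nv * Δ.c)) /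
        (Nv * (Δ.c * w (Fin.last m)) + Mv) ^ 2) (w (Fin.last m)) := by
    have h1 : HasDerivAt (fun τ : ℝ => M'v + N'v * (Δ.c * τ)) (N'v * Δ.c) (w (Fin.last m)) := by
      simpa using ((hasDerivAt_id (w (Fin.last m))).const_mul (Δ.c : ℝ)).const_mul N'v |>.const_add M'v
    have h2 : HasDerivAt (fun τ : ℝ => Nv * (Δ.c * τ) + Mv) (Nv * Δ.c) (w (Fin.last m)) := by
      simpa using ((hasDerivAt_id (w (Fin.last m))).const_mul (Δ.c : ℝ)).const_mul Nv |>.add_const Mv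
    exact h1.div h2 hden
  rw [← hfun] at hD
  rw [fn_thetaS_of_hasDerivAt (Δ.eS ℓ) hw hD, Δ.fn_headSD]
  simp only [Nv, Mv, N'v, M'v, ur] at hden ⊢
  set u := w (Fin.last m)
  set A1 := Δ.Nr ℓ w
  set A2 := Δ.Mr ℓ w
  set A3 := Δ.N'r ℓ w
  set A4 := Δ.M'r ℓ w
  have hden2 : A1 * (↑Δ.c * u) + A2 ≠ 0 := hden
  have hden3 : A1 * ↑Δ.c * u + A2 ≠ 0 := by rw [mul_assoc]; exact hden
  have hden4 : ↑Δ.c * u * A1 + A2 ≠ 0 := by rw [mul_comm (↑Δ.c * u) A1]; exact hden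
  field_simp
  ring

/-- **Boundary identity**: `δ last_ℓ = ĕ_ℓ + θ ĕ_ℓ` (`∂_u(u ĕ) = ∂_u e = δ last`). [folklore] -/
theorem fn_lastSD_eq (ℓ : ι) {w : Fin (m + 1) → ℝ} (hw : w ∈ KZ.cube (m + 1)) :
    (Δ.lastSD ℓ).fn w = (Δ.ebrS ℓ).fn w + (thetaS (Δ.ebrS ℓ)).fn w := by
  set Nv := Δ.Nr ℓ w
  set Mv := Δ.Mr ℓ w
  set N'v := Δ.N'r ℓ w
  set M'v := Δ.M'r ℓ w
  have hden : Nv * Δ.ur w + Mv ≠ 0 := Δ.denr_ne ℓ hw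
  have hM : Mv ≠ 0 := Δ.Mr_ne ℓ hw
  have hfun : (fun τ : ℝ => (Δ.ebrS ℓ).fn (Fin.snoc (Fin.init w) τ)) =
      fun τ => (N'v * Mv - M'v * Nv) / ((Nv * (Δ.c * τ) + Mv) * Mv) := by
    funext τ; rw [Δ.fn_ebrS]; simp [Nr, Mr, N'r, M'r, ur, Fin.init_snoc, Fin.snoc_last, Nv, Mv, N'v, M'v]
  have hD : HasDerivAt (fun τ : ℝ => (N'v * Mv - M'v * Nv) / ((Nv * (Δ.c * τ) + Mv) * Mv))
      ((0 * ((Nv * (Δ.c * w (Fin.last m)) + Mv) * Mv) - (N'v * Mv - M'v * Nv) * (Nv * Δ.c * Mv)) /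
        ((Nv * (Δ.c * w (Fin.last m)) + Mv) * Mv) ^ 2) (w (Fin.last m)) := by
    have h2 : HasDerivAt (fun τ : ℝ => (Nv * (Δ.c * τ) + Mv) * Mv) (Nv * Δ.c * Mv) (w (Fin.last m)) := by
      have := ((hasDerivAt_id (w (Fin.last m))).const_mul (Δ.c : ℝ)).const_mul Nv |>.add_const Mv |>.mul_const Mv
      simpa [mul_assoc] using this
    exact (hasDerivAt_const _ _).div h2 (mul_ne_zero hden hM)
  rw [← hfun] at hD
  rw [fn_thetaS_of_hasDerivAt (Δ.ebrS ℓ) hw hD, Δ.fn_lastSD, Δ.fn_ebrS]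
  simp only [Nv, Mv, N'v, M'v, ur] at hden hM ⊢
  set u := w (Fin.last m)
  set A1 := Δ.Nr ℓ w
  set A2 := Δ.Mr ℓ w
  set A3 := Δ.N'r ℓ w
  set A4 := Δ.M'r ℓ w
  have hden2 : A1 * (↑Δ.c * u) + A2 ≠ 0 := hden
  have hden3 : A1 * ↑Δ.c * u + A2 ≠ 0 := by rw [mul_assoc]; exact hden
  have hden4 : ↑Δ.c * u * A1 + A2 ≠ 0 := by rw [mul_comm (↑Δ.c * u) A1]; exact hden
  field_simp
  ring

/-- `θ e⁰_ℓ = 0` (no dependence on the scale). [folklore] -/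
theorem fn_thetaS_e0S (ℓ : ι) {w : Fin (m + 1) → ℝ} (hw : w ∈ KZ.cube (m + 1)) : (thetaS (Δ.e0S ℓ)).fn w = 0 := by
  have hfun : (fun τ : ℝ => (Δ.e0S ℓ).fn (Fin.snoc (Fin.init w) τ)) = fun _ => Δ.M'r ℓ w / Δ.Mr ℓ w := by
    funext τ; rw [Δ.fn_e0S]; simp [Mr, M'r, Fin.init_snoc]
  have hD : HasDerivAt (fun _ : ℝ => Δ.M'r ℓ w / Δ.Mr ℓ w) 0 (w (Fin.last m)) := hasDerivAt_const _ _
  rw [← hfun] at hD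
  rw [fn_thetaS_of_hasDerivAt (Δ.e0S ℓ) hw hD, mul_zero]

/-- **The multiplier relation** `c_{ℓ'} ĕ_ℓ + e⁰_ℓ last_{ℓ'} = last_{ℓ'} e_ℓ` (`c = u·last`, `u ĕ = e − e⁰`). [folklore] -/
theorem fn_rel1 (ℓ' ℓ : ι) {w : Fin (m + 1) → ℝ} (hw : w ∈ KZ.cube (m + 1)) :
    (headS Δ.c Δ.hc (Δ.d (some ℓ')) (Δ.hd (some ℓ'))).fn w * (Δ.ebrS ℓ).fn w + (Δ.e0S ℓ).fn w *
        (lastS Δ.c Δ.hc (Δ.d (some ℓ')) (Δ.hd (some ℓ'))).fn w =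
      (lastS Δ.c Δ.hc (Δ.d (some ℓ')) (Δ.hd (some ℓ'))).fn w * (Δ.eS ℓ).fn w := by
  have hden := Δ.denr_ne ℓ hw
  have hden' := Δ.denr_ne ℓ' hw
  have hM := Δ.Mr_ne ℓ hw
  rw [Δ.fn_headS_some, Δ.fn_lastS_some, Δ.fn_ebrS, Δ.fn_e0S, Δ.fn_eS]
  simp only [ur] at hden hden' ⊢
  set u := (Δ.c : ℝ) * w (Fin.last m)
  set A1 := Δ.Nr ℓ w
  set A2 := Δ.Mr ℓ w
  set A3 := Δ.N'r ℓ w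
  set A4 := Δ.M'r ℓ w
  set B1 := Δ.Nr ℓ' w
  set B2 := Δ.Mr ℓ' w
  have hden2 : u * A1 + A2 ≠ 0 := by rw [mul_comm]; exact hden
  have hden2' : u * B1 + B2 ≠ 0 := by rw [mul_comm]; exact hden'
  field_simp
  ring

end DirData

end DirValues

/-! ## (S) for scale-reading multipliers and for multiplier classes -/

section STransport

open Shuffle NCSeries

variable {R : Type} [CommRing R] [Algebra ℚ R] {χ : KZ.FormalRep →+ R} (hrel : ∀ c ∈ KZ.relations, χ c = 0)
variable {ι : Type} [Fintype ι] [DecidableEq ι] {m n k : ℕ}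
variable {A : Type} [Ring A] [Algebra R A]

include hrel

omit [Algebra ℚ R] [Fintype ι] [DecidableEq ι] in
/-- **(S) with a scale-reading factor**, word by word:
`⟪(ρ g[π]) Z_v[π]⟫ = ⟪(ρ⁺ g[πv]) ∂_τ(τZ_v)[πv]⟫ + ⟪(ρ⁺ (θg)[πv]) Z_v[πv]⟫`. [folklore] -/
theorem chi_famTerm_mul_scaleFam_S (g : RFun (m + 1)) (ρ : RFun (m + k)) (T : RFun ((n + m) + 1))
    (π : MvPolynomial (Fin (m + k)) ℚ) (hπ : IsScale π) :
    (famTerm (ρ.mul (scaleFam g π hπ)) T π hπ).chi χ =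
      (famTerm (k := k + 1) (ρ.lift.mul (scaleFam (m := m) (k := k + 1) g (scaleMul π) (isScale_scaleMul hπ))) (scaleDeriv T) (scaleMul π)
          (isScale_scaleMul hπ)).chi χ +
        (famTerm (k := k + 1) (ρ.lift.mul (scaleFam (m := m) (k := k + 1) (thetaS g) (scaleMul π) (isScale_scaleMul hπ))) T (scaleMul π)
          (isScale_scaleMul hπ)).chi χ := by
  rw [← chi_famTerm_smulS hrel ρ g T π hπ, chi_famTerm_eq_scaleDeriv hrel ρ (smulS g T) π hπ,
    chi_famTerm_scaleDeriv_smulS hrel]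

variable (c : ℚ) (hc : 0 ≤ c) (d : ι → Letter m) (hd : ∀ a, (d a).IsRegular c)

/-- **(S) with a scale-reading factor at residues**:
`ZS_j(ρ g[π], π) = DS_j(ρ⁺ g[πv], πv) + ZS_j(ρ⁺ (θg)[πv], πv)`. [folklore] -/
theorem ZS_mul_scaleFam_S (g : RFun (m + 1)) (j : ℕ) (t : ι → A) (o : ι) (ρ : RFun (m + k))
    (π : MvPolynomial (Fin (m + k)) ℚ) (hπ : IsScale π) :
    ZS (χ := χ) c hc d hd j t o (ρ.mul (scaleFam g π hπ)) π hπ =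
      DS (χ := χ) c hc d hd j t o (k := k + 1) (ρ.lift.mul (scaleFam (m := m) (k := k + 1) g (scaleMul π) (isScale_scaleMul hπ))) (scaleMul π)
          (isScale_scaleMul hπ) +
        ZS (χ := χ) c hc d hd j t o (k := k + 1) (ρ.lift.mul (scaleFam (m := m) (k := k + 1) (thetaS g) (scaleMul π) (isScale_scaleMul hπ)))
          (scaleMul π) (isScale_scaleMul hπ) := by
  unfold ZS DS
  rw [← evalW_add]
  congr 1
  funext W
  simp only [Zser, Dser, NCSeries.add_apply]
  split_ifs
  · simp
  · rw [← pair_add_fun']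
    exact pair_congr fun v _ => chi_famTerm_mul_scaleFam_S hrel g ρ _ π hπ

omit [Algebra ℚ R] [Fintype ι] [DecidableEq ι] in
/-- **(S) for a multiplier class**: `⟪ρ g[π]⟫ = ⟪ρ⁺ g[πv]⟫ + ⟪ρ⁺ (θg)[πv]⟫`. [folklore] -/
theorem chi_mul_scaleFam_S (g : RFun (m + 1)) (ρ : RFun (m + k)) (π : MvPolynomial (Fin (m + k)) ℚ) (hπ : IsScale π) :
    (ρ.mul (scaleFam g π hπ)).chi χ =
      (ρ.lift.mul (scaleFam (m := m) (k := k + 1) g (scaleMul π) (isScale_scaleMul hπ))).chi χ +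
        (ρ.lift.mul (scaleFam (m := m) (k := k + 1) (thetaS g) (scaleMul π) (isScale_scaleMul hπ))).chi χ := by
  have hπ' := isScale_scaleMul hπ
  -- as a family term with the constant word function on zero word coordinates
  have h1 : (ρ.mul (scaleFam g π hπ)).chi χ = (famTerm (n := 0) (ρ.mul (scaleFam g π hπ)) (RFun.const 1) π hπ).chi χ := by
    rw [chi_famTerm_zero_scaleOnly hrel (ρ.mul (scaleFam g π hπ)) (RFun.const 1) (RFun.const 1) (fun z => by
      rw [RFun.fn_const, RFun.fn_const]) π hπ]
    exact RFun.chi_congr hrel fun y _ => by simp only [RFun.fn_mul, fn_scaleFam, RFun.fn_const]; push_cast; ring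
  rw [h1, chi_famTerm_mul_scaleFam_S hrel g ρ (RFun.const 1) π hπ]
  -- `∂_τ(τ · 1) = 1`
  have h2 : (famTerm (n := 0) (k := k + 1) (ρ.lift.mul (scaleFam (m := m) (k := k + 1) g (scaleMul π) hπ')) (scaleDeriv (RFun.const 1))
      (scaleMul π) hπ').chi χ =
      (famTerm (n := 0) (k := k + 1) (ρ.lift.mul (scaleFam (m := m) (k := k + 1) g (scaleMul π) hπ')) (RFun.const 1) (scaleMul π) hπ').chi χ := by
    refine RFun.chi_congr hrel fun y hy => ?_
    have hz := famPt_mem (n := 0) hπ' hy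
    have hsplit : famPt 0 (scaleMul π) y = Fin.snoc (Fin.init (famPt 0 (scaleMul π) y)) (famPt 0 (scaleMul π) y (Fin.last _)) :=
      (Fin.snoc_init_self _).symm
    have hp : Fin.init (famPt 0 (scaleMul π) y) ∈ KZ.cube (0 + m) := fun i => hz _
    have ht : famPt 0 (scaleMul π) y (Fin.last _) ∈ Icc (0 : ℝ) 1 := ⟨(hz _).1, (hz _).2⟩
    have key : (scaleDeriv (RFun.const 1 : RFun ((0 + m) + 1))).fn (famPt 0 (scaleMul π) y) =
        (RFun.const 1 : RFun ((0 + m) + 1)).fn (famPt 0 (scaleMul π) y) := by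
      rw [hsplit, fn_scaleDeriv _ hp ht, ← RFun.pd_last, RFun.fn_pd_const, RFun.fn_const]; ring
    rw [fn_famTerm, fn_famTerm, key]
  rw [h2, chi_famTerm_zero_scaleOnly hrel _ (RFun.const 1) (RFun.const 1) (fun z => by rw [RFun.fn_const, RFun.fn_const]),
    chi_famTerm_zero_scaleOnly hrel _ (RFun.const 1) (RFun.const 1) (fun z => by rw [RFun.fn_const, RFun.fn_const])]
  refine congrArg₂ (· + ·) ?_ ?_
  · exact RFun.chi_congr hrel fun y _ => by rw [RFun.fn_mul, fn_scaleFam, RFun.fn_const]; push_cast; ring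
  · exact RFun.chi_congr hrel fun y _ => by rw [RFun.fn_mul, fn_scaleFam, RFun.fn_const]; push_cast; ring

end STransport


/-! ## The abstract ring identities behind the (U2)-step of transverse flatness -/

section TFAlgebra

open Finset

variable {R A : Type} [CommRing R] [Ring A] [Algebra R A] {ι : Type} [Fintype ι]

/-- **Generic step** of the transverse-flatness recursion: after expanding both sides by the
transport equation and the induction hypothesis, the two sides differ by the flatness junk
`Σ_a [t_a,T] Z[c_a] + Σ_{a,ℓ} [t_a,t_ℓ] Z[c_a e_ℓ]`, the axis junk `Z[1][T,t_o] + Σ_ℓ Z[e⁰_ℓ][t_ℓ,t_o]`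
and the closedness defect. [folklore] -/
theorem tf_step_generic (t : Option ι → A) (T : A)
    (Zc Zn' : Option ι → A) (Zce Zc0 : Option ι → ι → A) (Zce' Zc0' : ι → Option ι → A) (Z1 : A) (Ze Ze0 Znθ : ι → A)
    (hZce' : ∀ ℓ a, Zce' ℓ a = Zce a ℓ) (hZc0' : ∀ ℓ a, Zc0' ℓ a = Zc0 a ℓ)
    (closed : ∑ a, t a * Zn' a = ∑ ℓ, t (some ℓ) * Znθ ℓ)
    (junk1 : ∑ a, (t a * T - T * t a) * Zc a + ∑ a, ∑ ℓ, (t a * t (some ℓ) - t (some ℓ) * t a) * Zce a ℓ = 0)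
    (junk2 : Z1 * (T * t none - t none * T) + ∑ ℓ, Ze0 ℓ * (t (some ℓ) * t none - t none * t (some ℓ)) = 0) :
    ∑ a, t a * (Zn' a + (T * Zc a - Zc a * T + ∑ ℓ, (t (some ℓ) * Zce a ℓ - Zc0 a ℓ * t (some ℓ))))
      - (T * Z1 - Z1 * T + ∑ ℓ, (t (some ℓ) * Ze ℓ - Ze0 ℓ * t (some ℓ))) * t none
    = T * (∑ a, t a * Zc a - Z1 * t none) - (∑ a, t a * Zc a - Z1 * t none) * T
      + ∑ ℓ, (t (some ℓ) * (∑ a, t a * Zce' ℓ a - Ze ℓ * t none + Znθ ℓ)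
          - (∑ a, t a * Zc0' ℓ a - Ze0 ℓ * t none) * t (some ℓ)) := by
  simp only [hZce', hZc0']
  rw [← sub_eq_zero]
  have hclosed : ∑ a, t a * Zn' a - ∑ ℓ, t (some ℓ) * Znθ ℓ = 0 := sub_eq_zero.2 closed
  have key : (∑ a, t a * (Zn' a + (T * Zc a - Zc a * T + ∑ ℓ, (t (some ℓ) * Zce a ℓ - Zc0 a ℓ * t (some ℓ))))
      - (T * Z1 - Z1 * T + ∑ ℓ, (t (some ℓ) * Ze ℓ - Ze0 ℓ * t (some ℓ))) * t none)
      - (T * (∑ a, t a * Zc a - Z1 * t none) - (∑ a, t a * Zc a - Z1 * t none) * T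
      + ∑ ℓ, (t (some ℓ) * (∑ a, t a * Zce a ℓ - Ze ℓ * t none + Znθ ℓ)
          - (∑ a, t a * Zc0 a ℓ - Ze0 ℓ * t none) * t (some ℓ)))
      = (∑ a, (t a * T - T * t a) * Zc a + ∑ a, ∑ ℓ, (t a * t (some ℓ) - t (some ℓ) * t a) * Zce a ℓ)
        + (Z1 * (T * t none - t none * T) + ∑ ℓ, Ze0 ℓ * (t (some ℓ) * t none - t none * t (some ℓ)))
        + (∑ a, t a * Zn' a - ∑ ℓ, t (some ℓ) * Znθ ℓ) := by
    simp only [Finset.sum_add_distrib, Finset.sum_sub_distrib, mul_add, add_mul, mul_sub, sub_mul, Finset.mul_sum,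
      Finset.sum_mul, mul_assoc]
    rw [show (∑ ℓ, ∑ a, t (some ℓ) * (t a * Zce a ℓ)) = ∑ a, ∑ ℓ, t (some ℓ) * (t a * Zce a ℓ) from Finset.sum_comm,
      show (∑ ℓ, ∑ a, t a * (Zc0 a ℓ * t (some ℓ))) = ∑ a, ∑ ℓ, t a * (Zc0 a ℓ * t (some ℓ)) from Finset.sum_comm]
    abel
  rw [key, junk1, junk2, hclosed, add_zero, add_zero]

/-- **Boundary step** (word length one) of the transverse-flatness recursion. [folklore] -/
theorem tf_step_zero (t : Option ι → A) (T : A) (Zn' : Option ι → A) (Znθ : ι → A)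
    (La : Option ι → R) (one1 : R) (Lce : Option ι → ι → R) (Le LE LE0 : ι → R) (Lel Le0l : ι → Option ι → R)
    (hLa : La none = one1) (hLel : ∀ ℓ, Lel ℓ none = LE ℓ) (hLe0l : ∀ ℓ, Le0l ℓ none = LE0 ℓ)
    (hLce : ∀ ℓ, Lce none ℓ = Le ℓ)
    (hrel1 : ∀ ℓ' ℓ, Lce (some ℓ') ℓ + Le0l ℓ (some ℓ') = Lel ℓ (some ℓ'))
    (closed : ∑ a, t a * Zn' a = ∑ ℓ, t (some ℓ) * Znθ ℓ)
    (junk0 : ∑ ℓ, (Le ℓ) • (t none * t (some ℓ) - t (some ℓ) * t none)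
        + ∑ ℓ', (La (some ℓ')) • (t (some ℓ') * T - T * t (some ℓ'))
        + ∑ ℓ', ∑ ℓ, (Lel ℓ (some ℓ')) • (t (some ℓ') * t (some ℓ) - t (some ℓ) * t (some ℓ')) = 0) :
    ∑ a, t a * (Zn' a + ∑ ℓ, (Lce a ℓ) • t (some ℓ))
      - (∑ ℓ, (Le ℓ) • t (some ℓ)) * t none
    = T * (∑ a, t a * ((La a) • (1 : A)) - ((one1) • (1 : A)) * t none)
      - (∑ a, t a * ((La a) • (1 : A)) - ((one1) • (1 : A)) * t none) * T
      + ∑ ℓ, (t (some ℓ) * (∑ a, t a * ((Lel ℓ a) • (1 : A)) - ((LE ℓ) • (1 : A)) * t none + Znθ ℓ)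
          - (∑ a, t a * ((Le0l ℓ a) • (1 : A)) - ((LE0 ℓ) • (1 : A)) * t none) * t (some ℓ)) := by
  have hLce' : ∀ ℓ' ℓ, Lce (some ℓ') ℓ = Lel ℓ (some ℓ') - Le0l ℓ (some ℓ') := fun ℓ' ℓ =>
    eq_sub_of_add_eq (hrel1 ℓ' ℓ)
  have hclosed : ∑ a, t a * Zn' a - ∑ ℓ, t (some ℓ) * Znθ ℓ = 0 := sub_eq_zero.2 closed
  rw [← sub_eq_zero]
  have key : (∑ a, t a * (Zn' a + ∑ ℓ, (Lce a ℓ) • t (some ℓ))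
      - (∑ ℓ, (Le ℓ) • t (some ℓ)) * t none)
      - (T * (∑ a, t a * ((La a) • (1 : A)) - ((one1) • (1 : A)) * t none)
      - (∑ a, t a * ((La a) • (1 : A)) - ((one1) • (1 : A)) * t none) * T
      + ∑ ℓ, (t (some ℓ) * (∑ a, t a * ((Lel ℓ a) • (1 : A)) - ((LE ℓ) • (1 : A)) * t none + Znθ ℓ)
          - (∑ a, t a * ((Le0l ℓ a) • (1 : A)) - ((LE0 ℓ) • (1 : A)) * t none) * t (some ℓ)))
      = (∑ ℓ, (Le ℓ) • (t none * t (some ℓ) - t (some ℓ) * t none)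
        + ∑ ℓ', (La (some ℓ')) • (t (some ℓ') * T - T * t (some ℓ'))
        + ∑ ℓ', ∑ ℓ, (Lel ℓ (some ℓ')) • (t (some ℓ') * t (some ℓ) - t (some ℓ) * t (some ℓ')))
        + (∑ a, t a * Zn' a - ∑ ℓ, t (some ℓ) * Znθ ℓ) := by
    simp only [Fintype.sum_option, hLa, hLel, hLe0l, hLce, hLce', mul_smul_comm, smul_mul_assoc, mul_one, one_mul,
      sub_smul, smul_sub, Finset.mul_sum, Finset.sum_mul, Finset.sum_add_distrib,
      Finset.sum_sub_distrib, mul_sub, sub_mul, mul_add, add_mul]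
    rw [show (∑ x, ∑ x_1, Lel x_1 (some x) • (t (some x_1) * t (some x))) =
        ∑ x_1, ∑ x, Lel x_1 (some x) • (t (some x_1) * t (some x)) from Finset.sum_comm,
      show (∑ x, ∑ x_1, Le0l x (some x_1) • (t (some x_1) * t (some x))) =
        ∑ x_1, ∑ x, Le0l x (some x_1) • (t (some x_1) * t (some x)) from Finset.sum_comm]
    abel
  rw [key, junk0, hclosed, add_zero]

end TFAlgebra

/-! ## Congruences and vanishing of the residue-level functionals -/

section ZSLemmas

open Shuffle NCSeries

variable {R : Type} [CommRing R] [Algebra ℚ R] {χ : KZ.FormalRep →+ R} (hrel : ∀ c ∈ KZ.relations, χ c = 0)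
variable {ι : Type} [Fintype ι] [DecidableEq ι] {m n k : ℕ}
variable {A : Type} [Ring A] [Algebra R A]
variable (c : ℚ) (hc : 0 ≤ c) (d : ι → Letter m) (hd : ∀ a, (d a).IsRegular c)

include hrel

omit [Algebra ℚ R] [Fintype ι] [DecidableEq ι] in
/-- `zcoef` only depends on the values of the multiplier on the cube. [folklore] -/
theorem zcoef_congr_mult {ρ₁ ρ₂ : RFun (m + k)} (h : ∀ e ∈ KZ.cube (m + k), ρ₁.fn e = ρ₂.fn e)
    (π : MvPolynomial (Fin (m + k)) ℚ) (hπ : IsScale π) (v : List ι) :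
    zcoef (χ := χ) c hc d hd ρ₁ π hπ v = zcoef (χ := χ) c hc d hd ρ₂ π hπ v :=
  RFun.chi_congr hrel fun y hy => by rw [fn_famTerm, fn_famTerm, h _ (rider_mem_cube hy)]

omit [Algebra ℚ R] [Fintype ι] [DecidableEq ι] in
/-- A multiplier vanishing on the cube kills `zcoef`. [folklore] -/
theorem zcoef_eq_zero_of_mult {ρ₁ : RFun (m + k)} (h : ∀ e ∈ KZ.cube (m + k), ρ₁.fn e = 0)
    (π : MvPolynomial (Fin (m + k)) ℚ) (hπ : IsScale π) (v : List ι) :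
    zcoef (χ := χ) c hc d hd ρ₁ π hπ v = 0 :=
  RFun.chi_eq_zero hrel fun y hy => by rw [fn_famTerm, h _ (rider_mem_cube hy), zero_mul]

/-- `ZS` only depends on the values of the multiplier on the cube. [folklore] -/
theorem ZS_congr_mult {ρ₁ ρ₂ : RFun (m + k)} (h : ∀ e ∈ KZ.cube (m + k), ρ₁.fn e = ρ₂.fn e)
    (j : ℕ) (t : ι → A) (o : ι) (π : MvPolynomial (Fin (m + k)) ℚ) (hπ : IsScale π) :
    ZS (χ := χ) c hc d hd j t o ρ₁ π hπ = ZS (χ := χ) c hc d hd j t o ρ₂ π hπ := by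
  unfold ZS; congr 1; funext W
  simp only [Zser]
  split_ifs
  · rfl
  · exact pair_congr fun v _ => zcoef_congr_mult hrel c hc d hd h π hπ v

/-- A multiplier vanishing on the cube kills `ZS`. [folklore] -/
theorem ZS_eq_zero_of_mult {ρ₁ : RFun (m + k)} (h : ∀ e ∈ KZ.cube (m + k), ρ₁.fn e = 0)
    (j : ℕ) (t : ι → A) (o : ι) (π : MvPolynomial (Fin (m + k)) ℚ) (hπ : IsScale π) :
    ZS (χ := χ) c hc d hd j t o ρ₁ π hπ = 0 := by
  unfold ZS
  have hz : ∀ v, zcoef (χ := χ) c hc d hd ρ₁ π hπ v = (fun _ => (0 : R)) v :=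
    fun v => zcoef_eq_zero_of_mult hrel c hc d hd h π hπ v
  have : Zser (χ := χ) c hc d hd o ρ₁ π hπ = 0 := by
    funext W
    simp only [Zser, NCSeries.zero_apply]
    split_ifs
    · rfl
    · rw [pair_congr fun v _ => hz v, pair_zero']
  rw [this]; simp [evalW]

omit hrel

variable [Module ℚ A] [IsScalarTower ℚ R A]

omit [Fintype ι] in
/-- Word-by-word vanishing of coefficient combinations passes to the regularised series. [folklore] -/
theorem sum_Zser_smul_eq_zero {κ : Type} [Fintype κ] (ρs : κ → RFun (m + k)) (B : κ → A)
    (π : MvPolynomial (Fin (m + k)) ℚ) (hπ : IsScale π)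
    (h : ∀ v : List ι, ∑ i, zcoef (χ := χ) c hc d hd (ρs i) π hπ v • B i = 0) (o : ι) (W : List ι) :
    ∑ i, Zser (χ := χ) c hc d hd o (ρs i) π hπ W • B i = 0 := by
  by_cases hW0 : W = []
  · simp [Zser, hW0]
  · simp only [Zser, if_neg hW0, pair, Finsupp.sum, Finset.sum_smul, smul_assoc]
    rw [Finset.sum_comm]
    refine Finset.sum_eq_zero fun v _ => ?_
    rw [← Finset.smul_sum, h v, smul_zero]

/-- **Vanishing of a junk sum, functionals on the right**: if the coefficient combinations vanish
word by word, `Σᵢ Bᵢ · ZS_j(ρᵢ) = 0`. [folklore] -/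
theorem sum_mul_ZS_eq_zero {κ : Type} [Fintype κ] (ρs : κ → RFun (m + k)) (B : κ → A)
    (π : MvPolynomial (Fin (m + k)) ℚ) (hπ : IsScale π)
    (h : ∀ v : List ι, ∑ i, zcoef (χ := χ) c hc d hd (ρs i) π hπ v • B i = 0) (j : ℕ) (t : ι → A) (o : ι) :
    ∑ i, B i * ZS (χ := χ) c hc d hd j t o (ρs i) π hπ = 0 := by
  simp only [ZS, NCSeries.evalW, Finset.mul_sum]
  rw [Finset.sum_comm]
  refine Finset.sum_eq_zero fun f _ => ?_
  have h1 : ∀ i, B i * (Zser (χ := χ) c hc d hd o (ρs i) π hπ (List.ofFn f) • ((List.ofFn f).map t).prod) =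
      (Zser (χ := χ) c hc d hd o (ρs i) π hπ (List.ofFn f) • B i) * ((List.ofFn f).map t).prod := by
    intro i; rw [mul_smul_comm, smul_mul_assoc]
  simp only [h1]
  rw [← Finset.sum_mul, sum_Zser_smul_eq_zero c hc d hd ρs B π hπ h o, zero_mul]

/-- **Vanishing of a junk sum, functionals on the left**: `Σᵢ ZS_j(ρᵢ) · Bᵢ = 0`. [folklore] -/
theorem sum_ZS_mul_eq_zero {κ : Type} [Fintype κ] (ρs : κ → RFun (m + k)) (B : κ → A)
    (π : MvPolynomial (Fin (m + k)) ℚ) (hπ : IsScale π)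
    (h : ∀ v : List ι, ∑ i, zcoef (χ := χ) c hc d hd (ρs i) π hπ v • B i = 0) (j : ℕ) (t : ι → A) (o : ι) :
    ∑ i, ZS (χ := χ) c hc d hd j t o (ρs i) π hπ * B i = 0 := by
  simp only [ZS, NCSeries.evalW, Finset.sum_mul]
  rw [Finset.sum_comm]
  refine Finset.sum_eq_zero fun f _ => ?_
  have h1 : ∀ i, (Zser (χ := χ) c hc d hd o (ρs i) π hπ (List.ofFn f) • ((List.ofFn f).map t).prod) * B i =
      ((List.ofFn f).map t).prod * (Zser (χ := χ) c hc d hd o (ρs i) π hπ (List.ofFn f) • B i) := by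
    intro i; rw [smul_mul_assoc, mul_smul_comm]
  simp only [h1]
  rw [← Finset.mul_sum, sum_Zser_smul_eq_zero c hc d hd ρs B π hπ h o, mul_zero]

end ZSLemmas


/-! ## Rational values of the direction functions and the contracted connections -/

section DirRational

variable {R : Type} [CommRing R] [Algebra ℚ R]
variable {ι : Type} {m k : ℕ}
variable {A : Type} [Ring A] [Algebra R A]

/-- The rational value is determined by the real value at the rational point. [folklore] -/
theorem RFun.evalQ_eq_of_fn {M : ℕ} (g : RFun M) (w : Fin M → ℚ) (q : ℚ)
    (h : g.fn (fun i => (w i : ℝ)) = (q : ℝ)) : g.evalQ w = q :=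
  Rat.cast_injective (α := ℝ) (by rw [← RFun.fn_ratCast, h])

/-- `evalQ` of a product. [folklore] -/
theorem RFun.evalQ_mul {M : ℕ} (g₁ g₂ : RFun M) (w : Fin M → ℚ) : (g₁.mul g₂).evalQ w = g₁.evalQ w * g₂.evalQ w :=
  RFun.evalQ_eq_of_fn _ _ _ (by rw [RFun.fn_mul, RFun.fn_ratCast, RFun.fn_ratCast]; push_cast; rfl)

/-- `evalQ` of a constant. [folklore] -/
theorem RFun.evalQ_const {M : ℕ} (q : ℚ) (w : Fin M → ℚ) : (RFun.const q : RFun M).evalQ w = q :=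
  RFun.evalQ_eq_of_fn _ _ _ (by rw [RFun.fn_const])

namespace DirData

variable (Δ : DirData ι m)

/-- Rational slope at a rational (riders, scale) point. [folklore] -/
def Nq (ℓ : ι) (w : Fin (m + 1) → ℚ) : ℚ := MvPolynomial.eval (fun i => w (Fin.castSucc i)) (Δ.N ℓ)
/-- Rational intercept. [folklore] -/
def Mq (ℓ : ι) (w : Fin (m + 1) → ℚ) : ℚ := MvPolynomial.eval (fun i => w (Fin.castSucc i)) (Δ.M ℓ)
/-- Rational transverse derivative of the slope. [folklore] -/
def N'q (ℓ : ι) (w : Fin (m + 1) → ℚ) : ℚ := MvPolynomial.eval (fun i => w (Fin.castSucc i)) (Δ.N' ℓ)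
/-- Rational transverse derivative of the intercept. [folklore] -/
def M'q (ℓ : ι) (w : Fin (m + 1) → ℚ) : ℚ := MvPolynomial.eval (fun i => w (Fin.castSucc i)) (Δ.M' ℓ)
/-- Rational moving variable `u = c̄ τ`. [folklore] -/
def uq (w : Fin (m + 1) → ℚ) : ℚ := Δ.c * w (Fin.last m)
/-- `c_ℓ(u) = N u/(N u + M)`. [folklore] -/
def cq (ℓ : ι) (w : Fin (m + 1) → ℚ) : ℚ := Δ.Nq ℓ w * Δ.uq w / (Δ.Nq ℓ w * Δ.uq w + Δ.Mq ℓ w)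
/-- `last_ℓ(u) = N/(N u + M)`. [folklore] -/
def lq (ℓ : ι) (w : Fin (m + 1) → ℚ) : ℚ := Δ.Nq ℓ w / (Δ.Nq ℓ w * Δ.uq w + Δ.Mq ℓ w)
/-- `e_ℓ(u) = (M' + N' u)/(M + N u)`. [folklore] -/
def eq (ℓ : ι) (w : Fin (m + 1) → ℚ) : ℚ := (Δ.M'q ℓ w + Δ.N'q ℓ w * Δ.uq w) / (Δ.Nq ℓ w * Δ.uq w + Δ.Mq ℓ w)
/-- `e⁰_ℓ = M'/M`. [folklore] -/
def e0q (ℓ : ι) (w : Fin (m + 1) → ℚ) : ℚ := Δ.M'q ℓ w / Δ.Mq ℓ w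
/-- `ĕ_ℓ = (N'M − M'N)/((M + N u) M)`. [folklore] -/
def ebq (ℓ : ι) (w : Fin (m + 1) → ℚ) : ℚ :=
  (Δ.N'q ℓ w * Δ.Mq ℓ w - Δ.M'q ℓ w * Δ.Nq ℓ w) / ((Δ.Nq ℓ w * Δ.uq w + Δ.Mq ℓ w) * Δ.Mq ℓ w)

/-- Real slope at the cast point. [folklore] -/
theorem Nr_ratCast (ℓ : ι) (w : Fin (m + 1) → ℚ) : Δ.Nr ℓ (fun i => (w i : ℝ)) = (Δ.Nq ℓ w : ℝ) :=
  aeval_ratCast (fun i => w (Fin.castSucc i)) (Δ.N ℓ)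
/-- Real intercept at the cast point. [folklore] -/
theorem Mr_ratCast (ℓ : ι) (w : Fin (m + 1) → ℚ) : Δ.Mr ℓ (fun i => (w i : ℝ)) = (Δ.Mq ℓ w : ℝ) :=
  aeval_ratCast (fun i => w (Fin.castSucc i)) (Δ.M ℓ)
/-- Real `N'` at the cast point. [folklore] -/
theorem N'r_ratCast (ℓ : ι) (w : Fin (m + 1) → ℚ) : Δ.N'r ℓ (fun i => (w i : ℝ)) = (Δ.N'q ℓ w : ℝ) :=
  aeval_ratCast (fun i => w (Fin.castSucc i)) (Δ.N' ℓ)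
/-- Real `M'` at the cast point. [folklore] -/
theorem M'r_ratCast (ℓ : ι) (w : Fin (m + 1) → ℚ) : Δ.M'r ℓ (fun i => (w i : ℝ)) = (Δ.M'q ℓ w : ℝ) :=
  aeval_ratCast (fun i => w (Fin.castSucc i)) (Δ.M' ℓ)
/-- Real `u` at the cast point. [folklore] -/
theorem ur_ratCast (w : Fin (m + 1) → ℚ) : Δ.ur (fun i => (w i : ℝ)) = (Δ.uq w : ℝ) := by
  simp [ur, uq]

/-- The letter denominator does not vanish at rational points of the cube. [folklore] -/
theorem denq_ne (ℓ : ι) {w : Fin (m + 1) → ℚ} (hw : ∀ i, 0 ≤ w i ∧ w i ≤ 1) :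
    Δ.Nq ℓ w * Δ.uq w + Δ.Mq ℓ w ≠ 0 := by
  have h := Δ.denr_ne ℓ (w := fun i => (w i : ℝ))
    (fun i => ⟨show (0 : ℝ) ≤ (w i : ℝ) by exact_mod_cast (hw i).1, show (w i : ℝ) ≤ 1 by exact_mod_cast (hw i).2⟩)
  rw [Nr_ratCast, Mr_ratCast, ur_ratCast] at h
  exact_mod_cast h

/-- The intercept does not vanish at rational points of the cube. [folklore] -/
theorem Mq_ne (ℓ : ι) {w : Fin (m + 1) → ℚ} (hw : ∀ i, 0 ≤ w i ∧ w i ≤ 1) : Δ.Mq ℓ w ≠ 0 := by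
  have h := Δ.Mr_ne ℓ (w := fun i => (w i : ℝ))
    (fun i => ⟨show (0 : ℝ) ≤ (w i : ℝ) by exact_mod_cast (hw i).1, show (w i : ℝ) ≤ 1 by exact_mod_cast (hw i).2⟩)
  rw [Mr_ratCast] at h
  exact_mod_cast h

/-- `evalQ` of the head factor of a divisor letter. [folklore] -/
theorem evalQ_headS_some (ℓ : ι) (w : Fin (m + 1) → ℚ) :
    (headS Δ.c Δ.hc (Δ.d (some ℓ)) (Δ.hd (some ℓ))).evalQ w = Δ.cq ℓ w :=
  RFun.evalQ_eq_of_fn _ _ _ (by rw [fn_headS_some, Nr_ratCast, Mr_ratCast, ur_ratCast, cq]; push_cast; rfl)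
/-- `evalQ` of the head factor of the axis letter. [folklore] -/
theorem evalQ_headS_none (w : Fin (m + 1) → ℚ) : (headS Δ.c Δ.hc (Δ.d none) (Δ.hd none)).evalQ w = 1 :=
  RFun.evalQ_eq_of_fn _ _ _ (by rw [fn_headS_none]; push_cast; rfl)
/-- `evalQ` of the last factor of a divisor letter. [folklore] -/
theorem evalQ_lastS_some (ℓ : ι) (w : Fin (m + 1) → ℚ) :
    (lastS Δ.c Δ.hc (Δ.d (some ℓ)) (Δ.hd (some ℓ))).evalQ w = Δ.lq ℓ w :=
  RFun.evalQ_eq_of_fn _ _ _ (by rw [fn_lastS_some, Nr_ratCast, Mr_ratCast, ur_ratCast, lq]; push_cast; rfl)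
/-- `evalQ` of the last factor of the axis letter. [folklore] -/
theorem evalQ_lastS_none (w : Fin (m + 1) → ℚ) : (lastS Δ.c Δ.hc (Δ.d none) (Δ.hd none)).evalQ w = 1 :=
  RFun.evalQ_eq_of_fn _ _ _ (by rw [fn_lastS_none]; push_cast; rfl)
/-- `evalQ` of `eS`. [folklore] -/
theorem evalQ_eS (ℓ : ι) (w : Fin (m + 1) → ℚ) : (Δ.eS ℓ).evalQ w = Δ.eq ℓ w :=
  RFun.evalQ_eq_of_fn _ _ _ (by rw [fn_eS, Nr_ratCast, Mr_ratCast, N'r_ratCast, M'r_ratCast, ur_ratCast, eq]; push_cast; rfl)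
/-- `evalQ` of `e0S`. [folklore] -/
theorem evalQ_e0S (ℓ : ι) (w : Fin (m + 1) → ℚ) : (Δ.e0S ℓ).evalQ w = Δ.e0q ℓ w :=
  RFun.evalQ_eq_of_fn _ _ _ (by rw [fn_e0S, Mr_ratCast, M'r_ratCast, e0q]; push_cast; rfl)
/-- `evalQ` of `ebrS`. [folklore] -/
theorem evalQ_ebrS (ℓ : ι) (w : Fin (m + 1) → ℚ) : (Δ.ebrS ℓ).evalQ w = Δ.ebq ℓ w :=
  RFun.evalQ_eq_of_fn _ _ _ (by
    rw [fn_ebrS, Nr_ratCast, Mr_ratCast, N'r_ratCast, M'r_ratCast, ur_ratCast, ebq]; push_cast; rfl)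

/-- `c = u · last`. [folklore] -/
theorem cq_eq_uq_mul_lq (ℓ : ι) (w : Fin (m + 1) → ℚ) : Δ.cq ℓ w = Δ.uq w * Δ.lq ℓ w := by
  simp only [cq, lq]; ring

/-- `u ĕ = e − e⁰`. [folklore] -/
theorem uq_mul_ebq (ℓ : ι) {w : Fin (m + 1) → ℚ} (hw : ∀ i, 0 ≤ w i ∧ w i ≤ 1) :
    Δ.uq w * Δ.ebq ℓ w = Δ.eq ℓ w - Δ.e0q ℓ w := by
  have h1 := Δ.denq_ne ℓ hw
  have h2 := Δ.Mq_ne ℓ hw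
  have h1' : Δ.uq w * Δ.Nq ℓ w + Δ.Mq ℓ w ≠ 0 := by rw [mul_comm]; exact h1
  simp only [ebq, eq, e0q]
  field_simp
  ring

/-- The point on the face `u = 0` below a rational point. [folklore] -/
def fz (w : Fin (m + 1) → ℚ) : Fin (m + 1) → ℚ := Function.update w (Fin.last m) 0

/-- Riders of the face point. [folklore] -/
theorem fz_castSucc (w : Fin (m + 1) → ℚ) (i : Fin m) : fz w (Fin.castSucc i) = w (Fin.castSucc i) := by
  rw [fz, Function.update_of_ne (Fin.castSucc_lt_last i).ne]

/-- The scale of the face point. [folklore] -/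
@[simp] theorem fz_last (w : Fin (m + 1) → ℚ) : fz w (Fin.last m) = 0 := by
  rw [fz, Function.update_self]

/-- The face point lies in the closed cube. [folklore] -/
theorem fz_mem {w : Fin (m + 1) → ℚ} (hw : ∀ i, 0 ≤ w i ∧ w i ≤ 1) : ∀ i, 0 ≤ fz w i ∧ fz w i ≤ 1 := by
  intro i
  by_cases hi : i = Fin.last m
  · subst hi; rw [fz_last]; exact ⟨le_rfl, zero_le_one⟩
  · rw [fz, Function.update_of_ne hi]; exact hw i

/-- Data at the face point. [folklore] -/
theorem face_data (ℓ : ι) (w : Fin (m + 1) → ℚ) :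
    Δ.Nq ℓ (fz w) = Δ.Nq ℓ w ∧ Δ.Mq ℓ (fz w) = Δ.Mq ℓ w ∧ Δ.N'q ℓ (fz w) = Δ.N'q ℓ w ∧
      Δ.M'q ℓ (fz w) = Δ.M'q ℓ w ∧ Δ.uq (fz w) = 0 := by
  have hf : (fun i => fz w (Fin.castSucc i)) = fun i => w (Fin.castSucc i) := funext (fz_castSucc w)
  refine ⟨by rw [Nq, Nq, hf], by rw [Mq, Mq, hf], by rw [N'q, N'q, hf], by rw [M'q, M'q, hf], ?_⟩
  simp [uq]

/-- `c_ℓ = 0` on the face. [folklore] -/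
theorem cq_fz (ℓ : ι) (w : Fin (m + 1) → ℚ) : Δ.cq ℓ (fz w) = 0 := by
  rw [cq, (Δ.face_data ℓ w).2.2.2.2]; simp

/-- `e_ℓ = e⁰_ℓ` on the face. [folklore] -/
theorem eq_fz (ℓ : ι) (w : Fin (m + 1) → ℚ) : Δ.eq ℓ (fz w) = Δ.e0q ℓ w := by
  obtain ⟨h1, h2, h3, h4, h5⟩ := Δ.face_data ℓ w
  rw [eq, e0q, h1, h2, h3, h4, h5]; simp

/-- `e⁰_ℓ` does not see the scale. [folklore] -/
theorem e0q_fz (ℓ : ι) (w : Fin (m + 1) → ℚ) : Δ.e0q ℓ (fz w) = Δ.e0q ℓ w := by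
  obtain ⟨h1, h2, h3, h4, h5⟩ := Δ.face_data ℓ w
  rw [e0q, e0q, h2, h4]

variable [Fintype ι]

variable (R) in
/-- **The contracted moving connection** `Ω = u Ω_u = t_axis + Σ_ℓ c_ℓ(u) t_ℓ` at a rational point,
with coefficients in `R`. [cite: KontsevichZagier2001, §1.1] -/
def Om (t : Option ι → A) (w : Fin (m + 1) → ℚ) : A := t none + ∑ ℓ, algebraMap ℚ R (Δ.cq ℓ w) • t (some ℓ)

variable (R) in
/-- **The contracted transverse connection** `Ω⊥ = p Ω_p = t_⊥ + Σ_ℓ e_ℓ(u) t_ℓ`. [cite: KontsevichZagier2001, §1.1] -/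
def OmT (t : Option ι → A) (tT : A) (w : Fin (m + 1) → ℚ) : A := tT + ∑ ℓ, algebraMap ℚ R (Δ.eq ℓ w) • t (some ℓ)

omit [Algebra ℚ R] in
/-- **Expansion of the commutator** `[Ω, Ω⊥]` over letters. [folklore] -/
theorem comm_expand (t : Option ι → A) (T : A) (cq eq : ι → R) :
    (t none + ∑ ℓ, cq ℓ • t (some ℓ)) * (T + ∑ ℓ, eq ℓ • t (some ℓ)) -
      (T + ∑ ℓ, eq ℓ • t (some ℓ)) * (t none + ∑ ℓ, cq ℓ • t (some ℓ)) =
    (t none * T - T * t none) + ∑ ℓ, eq ℓ • (t none * t (some ℓ) - t (some ℓ) * t none)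
      + ∑ ℓ', cq ℓ' • (t (some ℓ') * T - T * t (some ℓ'))
      + ∑ ℓ', ∑ ℓ, (cq ℓ' * eq ℓ) • (t (some ℓ') * t (some ℓ) - t (some ℓ) * t (some ℓ')) := by
  simp only [add_mul, mul_add, Finset.sum_mul, Finset.mul_sum, smul_mul_assoc, mul_smul_comm, smul_add, smul_sub,
    Finset.smul_sum, smul_smul, Finset.sum_add_distrib, Finset.sum_sub_distrib, mul_comm (eq _) (cq _)]
  rw [show (∑ x, ∑ i, (cq i * eq x) • (t (some i) * t (some x))) = ∑ i, ∑ x, (cq i * eq x) • (t (some i) * t (some x))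
    from Finset.sum_comm]
  abel

omit [Algebra ℚ R] in
/-- **The divided flatness pattern**:
`u · (Σ ĕ[t₀,t] + Σ last[t,T] + ΣΣ last·e [t,t]) = [Ω,Ω⊥](u) − [Ω,Ω⊥](0)` expanded. [folklore] -/
theorem divided_expand (t : Option ι → A) (T : A) (u : R) (lq eq e0q ebq : ι → R)
    (hq : ∀ ℓ, u * ebq ℓ = eq ℓ - e0q ℓ) :
    u • (∑ ℓ, ebq ℓ • (t none * t (some ℓ) - t (some ℓ) * t none)
        + ∑ ℓ', lq ℓ' • (t (some ℓ') * T - T * t (some ℓ'))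
        + ∑ ℓ', ∑ ℓ, (lq ℓ' * eq ℓ) • (t (some ℓ') * t (some ℓ) - t (some ℓ) * t (some ℓ'))) =
    ((t none * T - T * t none) + ∑ ℓ, eq ℓ • (t none * t (some ℓ) - t (some ℓ) * t none)
      + ∑ ℓ', (u * lq ℓ') • (t (some ℓ') * T - T * t (some ℓ'))
      + ∑ ℓ', ∑ ℓ, ((u * lq ℓ') * eq ℓ) • (t (some ℓ') * t (some ℓ) - t (some ℓ) * t (some ℓ')))
    - ((t none * T - T * t none) + ∑ ℓ, e0q ℓ • (t none * t (some ℓ) - t (some ℓ) * t none)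
      + ∑ ℓ', (0 : R) • (t (some ℓ') * T - T * t (some ℓ'))
      + ∑ ℓ', ∑ ℓ, ((0 : R) * e0q ℓ) • (t (some ℓ') * t (some ℓ) - t (some ℓ) * t (some ℓ'))) := by
  have hq' : ∀ ℓ, eq ℓ = u * ebq ℓ + e0q ℓ := fun ℓ => by rw [hq]; ring
  simp only [zero_mul, zero_smul, Finset.sum_const_zero, add_zero]
  rw [eq_sub_iff_add_eq]
  simp only [smul_add, smul_sub, Finset.smul_sum, smul_smul, hq', add_smul, Finset.sum_add_distrib,
    Finset.sum_sub_distrib, mul_add, mul_assoc]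
  abel

/-- `[Ω, Ω⊥]` at a rational point, expanded with the rational data. [folklore] -/
theorem comm_Om_OmT (t : Option ι → A) (tT : A) (w : Fin (m + 1) → ℚ) :
    Δ.Om R t w * Δ.OmT R t tT w - Δ.OmT R t tT w * Δ.Om R t w =
    (t none * tT - tT * t none) + ∑ ℓ, algebraMap ℚ R (Δ.eq ℓ w) • (t none * t (some ℓ) - t (some ℓ) * t none)
      + ∑ ℓ', algebraMap ℚ R (Δ.cq ℓ' w) • (t (some ℓ') * tT - tT * t (some ℓ'))
      + ∑ ℓ', ∑ ℓ, (algebraMap ℚ R (Δ.cq ℓ' w) * algebraMap ℚ R (Δ.eq ℓ w)) •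
          (t (some ℓ') * t (some ℓ) - t (some ℓ) * t (some ℓ')) :=
  comm_expand t tT _ _

end DirData

end DirRational


/-! ## Transverse flatness (TF-Z): the transverse derivative of the regularised transport -/

section TFZ

open Shuffle NCSeries

variable {R : Type} [CommRing R] [Algebra ℚ R] {χ : KZ.FormalRep →+ R} (hrel : ∀ c ∈ KZ.relations, χ c = 0)
variable {ι : Type} [Fintype ι] [DecidableEq ι] {m n k : ℕ}
variable {A : Type} [Ring A] [Algebra R A] [Module ℚ A] [IsScalarTower ℚ R A]
variable (Δ : DirData ι m) (t : Option ι → A) (tT : A)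

namespace DirData

variable (R) in
/-- **The flatness hypothesis (F1)**: the contracted connections `Ω = uΩ_u` and `Ω⊥ = pΩ_p` commute
at every rational point of the open unit box. [cite: KontsevichZagier2001, §1.1] -/
def Flat : Prop := ∀ w : Fin (m + 1) → ℚ, (∀ i, 0 < w i ∧ w i < 1) → Commute (Δ.Om R t w) (Δ.OmT R t tT w)

/-- **TF-Z in degree `n + 1`**: the transverse derivative of the regularised `Z`-series,
`δ𝐙_{n+1} = [t_⊥, 𝐙_n] + Σ_ℓ (t_ℓ 𝐙_n[e_ℓ] − 𝐙_n[e⁰_ℓ] t_ℓ) + [n=0] Σ_ℓ ⟪ĕ_ℓ⟫ t_ℓ`, for all riders,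
multipliers and scales. [cite: IharaKanekoZagier2006, §3] -/
def TFZ (n : ℕ) : Prop :=
  ∀ (k : ℕ) (ρ : RFun (m + k)) (π : MvPolynomial (Fin (m + k)) ℚ) (hπ : IsScale π),
    Δ.YS (χ := χ) (n + 1) t ρ π hπ =
      tT * ZS (χ := χ) Δ.c Δ.hc Δ.d Δ.hd n t none ρ π hπ - ZS (χ := χ) Δ.c Δ.hc Δ.d Δ.hd n t none ρ π hπ * tT +
      ∑ ℓ, (t (some ℓ) * ZS (χ := χ) Δ.c Δ.hc Δ.d Δ.hd n t none (ρ.mul (scaleFam (Δ.eS ℓ) π hπ)) π hπ -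
        ZS (χ := χ) Δ.c Δ.hc Δ.d Δ.hd n t none (ρ.mul (scaleFam (Δ.e0S ℓ) π hπ)) π hπ * t (some ℓ)) +
      (if n = 0 then ∑ ℓ, (ρ.mul (scaleFam (Δ.ebrS ℓ) π hπ)).chi χ • t (some ℓ) else 0)

/-! ### The flatness junk -/

/-- The multipliers of the flatness junk. [folklore] -/
def mu1 : Option ι ⊕ (Option ι × ι) → RFun (m + 1) :=
  Sum.elim (fun a => headS Δ.c Δ.hc (Δ.d a) (Δ.hd a)) (fun q => (headS Δ.c Δ.hc (Δ.d q.1) (Δ.hd q.1)).mul (Δ.eS q.2))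

/-- The brackets of the flatness junk. [folklore] -/
def B1 : Option ι ⊕ (Option ι × ι) → A :=
  Sum.elim (fun a => t a * tT - tT * t a) (fun q => t q.1 * t (some q.2) - t (some q.2) * t q.1)

omit [DecidableEq ι] [Module ℚ A] [IsScalarTower ℚ R A] in
/-- The flatness junk at a rational point is the commutator `[Ω, Ω⊥]`. [folklore] -/
theorem sum_mu1 (w : Fin (m + 1) → ℚ) :
    ∑ i, algebraMap ℚ R ((Δ.mu1 i).evalQ w) • B1 t tT i = Δ.Om R t w * Δ.OmT R t tT w - Δ.OmT R t tT w * Δ.Om R t w := by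
  rw [comm_Om_OmT]
  simp only [mu1, B1, Fintype.sum_sum_type, Fintype.sum_prod_type, Fintype.sum_option, Sum.elim_inl, Sum.elim_inr,
    RFun.evalQ_mul, evalQ_headS_none, evalQ_headS_some, evalQ_eS, map_one, one_smul, one_mul, map_mul]
  abel

/-- **Flatness on the closed cube** (by the polynomial identity principle). [folklore] -/
theorem flat_closed (hF : Δ.Flat R t tT) {w : Fin (m + 1) → ℚ} (hw : ∀ i, 0 ≤ w i ∧ w i ≤ 1) :
    Δ.Om R t w * Δ.OmT R t tT w - Δ.OmT R t tT w * Δ.Om R t w = 0 := by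
  rw [← sum_mu1]
  exact smul_sum_eq_zero_closure (R := R) (fun (q : ℚ) (b : A) => algebraMap_smul R q b) Δ.mu1 (B1 t tT)
    (fun x hx => by rw [sum_mu1]; exact sub_eq_zero.2 (hF x hx)) hw

include hrel

/-- **The flatness junk vanishes**:
`Σ_a [t_a, T] Z[c_a] + Σ_{a,ℓ} [t_a, t_ℓ] Z[c_a e_ℓ] = 0`. [folklore] -/
theorem junk1_Z (hF : Δ.Flat R t tT) (p : ℕ) (ρ : RFun (m + k)) (π : MvPolynomial (Fin (m + k)) ℚ) (hπ : IsScale π) :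
    ∑ a, (t a * tT - tT * t a) * ZS (χ := χ) Δ.c Δ.hc Δ.d Δ.hd p t none (ρ.mul (headMult Δ.c Δ.hc (Δ.d a) (Δ.hd a) π hπ)) π hπ +
    ∑ a, ∑ ℓ, (t a * t (some ℓ) - t (some ℓ) * t a) *
        ZS (χ := χ) Δ.c Δ.hc Δ.d Δ.hd p t none
          ((ρ.mul (headMult Δ.c Δ.hc (Δ.d a) (Δ.hd a) π hπ)).mul (scaleFam (Δ.eS ℓ) π hπ)) π hπ = 0 := by
  set ρs : Option ι ⊕ (Option ι × ι) → RFun (m + k) :=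
    Sum.elim (fun a => ρ.mul (headMult Δ.c Δ.hc (Δ.d a) (Δ.hd a) π hπ))
      (fun q => (ρ.mul (headMult Δ.c Δ.hc (Δ.d q.1) (Δ.hd q.1) π hπ)).mul (scaleFam (Δ.eS q.2) π hπ)) with hρs
  have hv : ∀ v : List (Option ι), ∑ i, zcoef (χ := χ) Δ.c Δ.hc Δ.d Δ.hd (ρs i) π hπ v • B1 t tT i = 0 := by
    intro v
    have hk := chi_famTerm_kill hrel (A := A) (fun (q : ℚ) (b : A) => algebraMap_smul R q b) Δ.mu1 (B1 t tT)
      (fun x hx => by rw [sum_mu1]; exact sub_eq_zero.2 (hF x hx)) ρ (Zw Δ.c Δ.hc Δ.d Δ.hd v) π hπ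
    rw [← hk]
    refine Finset.sum_congr rfl fun i _ => congrArg (· • B1 t tT i) ?_
    cases i with
    | inl a => rfl
    | inr q =>
      refine zcoef_congr_mult hrel Δ.c Δ.hc Δ.d Δ.hd (fun e _ => ?_) π hπ v
      simp only [hρs, Sum.elim_inr, mu1, RFun.fn_mul, headMult, fn_scaleFam]
      ring
  have := sum_mul_ZS_eq_zero (χ := χ) Δ.c Δ.hc Δ.d Δ.hd ρs (B1 t tT) π hπ hv p t none
  simpa only [Fintype.sum_sum_type, Fintype.sum_prod_type, hρs, Sum.elim_inl, Sum.elim_inr, B1] using this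

/-- **The axis junk vanishes**: `Z[1][T, t_o] + Σ_ℓ Z[e⁰_ℓ][t_ℓ, t_o] = 0` (flatness at `u = 0`). [folklore] -/
theorem junk2_Z (hF : Δ.Flat R t tT) (p : ℕ) (ρ : RFun (m + k)) (π : MvPolynomial (Fin (m + k)) ℚ) (hπ : IsScale π) :
    ZS (χ := χ) Δ.c Δ.hc Δ.d Δ.hd p t none ρ π hπ * (tT * t none - t none * tT) +
    ∑ ℓ, ZS (χ := χ) Δ.c Δ.hc Δ.d Δ.hd p t none (ρ.mul (scaleFam (Δ.e0S ℓ) π hπ)) π hπ *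
        (t (some ℓ) * t none - t none * t (some ℓ)) = 0 := by
  set μ₂ : Option ι → RFun (m + 1) := fun a => a.elim (RFun.const 1) fun ℓ => Δ.e0S ℓ with hμ₂
  set B₂ : Option ι → A := fun a => a.elim (tT * t none - t none * tT) fun ℓ => t (some ℓ) * t none - t none * t (some ℓ)
    with hB₂
  have hpt : ∀ x : Fin (m + 1) → ℚ, (∀ i, 0 < x i ∧ x i < 1) → ∑ a, algebraMap ℚ R ((μ₂ a).evalQ x) • B₂ a = 0 := by
    intro x hx
    have h0 := Δ.flat_closed t tT hF (fz_mem fun i => ⟨(hx i).1.le, (hx i).2.le⟩ : ∀ i, 0 ≤ fz x i ∧ fz x i ≤ 1)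
    rw [comm_Om_OmT] at h0
    simp only [cq_fz, eq_fz, map_zero, zero_smul, zero_mul, Finset.sum_const_zero, add_zero] at h0
    simp only [hμ₂, hB₂, Fintype.sum_option, Option.elim, RFun.evalQ_const, evalQ_e0S, map_one, one_smul]
    have : (tT * t none - t none * tT) + ∑ ℓ, algebraMap ℚ R (Δ.e0q ℓ x) • (t (some ℓ) * t none - t none * t (some ℓ)) =
        -((t none * tT - tT * t none) +
          ∑ ℓ, algebraMap ℚ R (Δ.e0q ℓ x) • (t none * t (some ℓ) - t (some ℓ) * t none)) := by
      rw [neg_add, ← Finset.sum_neg_distrib]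
      congr 1
      · exact (neg_sub _ _).symm
      · exact Finset.sum_congr rfl fun ℓ _ => by rw [← smul_neg, neg_sub]
    rw [this, h0, neg_zero]
  set ρs : Option ι → RFun (m + k) := fun a => a.elim ρ fun ℓ => ρ.mul (scaleFam (Δ.e0S ℓ) π hπ) with hρs
  have hv : ∀ v : List (Option ι), ∑ i, zcoef (χ := χ) Δ.c Δ.hc Δ.d Δ.hd (ρs i) π hπ v • B₂ i = 0 := by
    intro v
    have hk := chi_famTerm_kill hrel (A := A) (fun (q : ℚ) (b : A) => algebraMap_smul R q b) μ₂ B₂ hpt ρ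
      (Zw Δ.c Δ.hc Δ.d Δ.hd v) π hπ
    rw [← hk]
    refine Finset.sum_congr rfl fun i _ => congrArg (· • B₂ i) ?_
    cases i with
    | none =>
      refine zcoef_congr_mult hrel Δ.c Δ.hc Δ.d Δ.hd (fun e _ => ?_) π hπ v
      simp only [hρs, hμ₂, Option.elim, RFun.fn_mul, fn_scaleFam, RFun.fn_const]; push_cast; ring
    | some ℓ => rfl
  have := sum_ZS_mul_eq_zero (χ := χ) Δ.c Δ.hc Δ.d Δ.hd ρs B₂ π hπ hv p t none
  simpa only [Fintype.sum_option, hρs, hB₂, Option.elim] using this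

omit [Algebra ℚ R] [Fintype ι] [DecidableEq ι] [Module ℚ A] [IsScalarTower ℚ R A] in
/-- A family term with the constant word function on zero word coordinates is the multiplier class. [folklore] -/
theorem chi_famTerm_const_one (ρ : RFun (m + k)) (π : MvPolynomial (Fin (m + k)) ℚ) (hπ : IsScale π) :
    (famTerm (n := 0) ρ (RFun.const 1) π hπ).chi χ = ρ.chi χ := by
  have h3 : ∀ y ∈ KZ.cube (0 + (m + k)), (famTerm (n := 0) ρ (RFun.const 1) π hπ).fn y = (ρ.pre 0).fn y :=
    fun y _ => by rw [fn_famTerm, RFun.fn_const, RFun.fn_pre]; push_cast; ring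
  rw [RFun.chi_congr hrel h3, RFun.pre_eq_rename_liftN, RFun.chi_rename hrel, RFun.chi_liftN hrel]

/-- **The boundary junk vanishes** (word length one):
`Σ_ℓ ⟪ĕ_ℓ⟫[t_o,t_ℓ] + Σ_ℓ' ⟪last_ℓ'⟫[t_ℓ',T] + ΣΣ ⟪last_ℓ' e_ℓ⟫[t_ℓ',t_ℓ] = 0` (the divided flatness). [folklore] -/
theorem junk0_chi (hc0 : 0 < Δ.c) (hF : Δ.Flat R t tT) (ρ : RFun (m + k)) (π : MvPolynomial (Fin (m + k)) ℚ)
    (hπ : IsScale π) :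
    ∑ ℓ, (ρ.mul (scaleFam (Δ.ebrS ℓ) π hπ)).chi χ • (t none * t (some ℓ) - t (some ℓ) * t none)
    + ∑ ℓ', (ρ.mul (lastMult Δ.c Δ.hc (Δ.d (some ℓ')) (Δ.hd (some ℓ')) π hπ)).chi χ •
        (t (some ℓ') * tT - tT * t (some ℓ'))
    + ∑ ℓ', ∑ ℓ, ((ρ.mul (scaleFam (Δ.eS ℓ) π hπ)).mul (lastMult Δ.c Δ.hc (Δ.d (some ℓ')) (Δ.hd (some ℓ')) π hπ)).chi χ •
        (t (some ℓ') * t (some ℓ) - t (some ℓ) * t (some ℓ')) = 0 := by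
  set μ₀ : ι ⊕ (ι ⊕ (ι × ι)) → RFun (m + 1) :=
    Sum.elim (fun ℓ => Δ.ebrS ℓ) (Sum.elim (fun ℓ' => lastS Δ.c Δ.hc (Δ.d (some ℓ')) (Δ.hd (some ℓ')))
      (fun q => (lastS Δ.c Δ.hc (Δ.d (some q.1)) (Δ.hd (some q.1))).mul (Δ.eS q.2))) with hμ₀
  set B₀ : ι ⊕ (ι ⊕ (ι × ι)) → A :=
    Sum.elim (fun ℓ => t none * t (some ℓ) - t (some ℓ) * t none) (Sum.elim (fun ℓ' => t (some ℓ') * tT - tT * t (some ℓ'))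
      (fun q => t (some q.1) * t (some q.2) - t (some q.2) * t (some q.1))) with hB₀
  -- the pointwise divided flatness
  have hpt : ∀ x : Fin (m + 1) → ℚ, (∀ i, 0 < x i ∧ x i < 1) → ∑ i, algebraMap ℚ R ((μ₀ i).evalQ x) • B₀ i = 0 := by
    intro x hx
    have hx' : ∀ i, 0 ≤ x i ∧ x i ≤ 1 := fun i => ⟨(hx i).1.le, (hx i).2.le⟩
    have hX : ∑ i, algebraMap ℚ R ((μ₀ i).evalQ x) • B₀ i =
        ∑ ℓ, algebraMap ℚ R (Δ.ebq ℓ x) • (t none * t (some ℓ) - t (some ℓ) * t none)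
        + ∑ ℓ', algebraMap ℚ R (Δ.lq ℓ' x) • (t (some ℓ') * tT - tT * t (some ℓ'))
        + ∑ ℓ', ∑ ℓ, (algebraMap ℚ R (Δ.lq ℓ' x) * algebraMap ℚ R (Δ.eq ℓ x)) •
            (t (some ℓ') * t (some ℓ) - t (some ℓ) * t (some ℓ')) := by
      simp only [hμ₀, hB₀, Fintype.sum_sum_type, Fintype.sum_prod_type, Sum.elim_inl, Sum.elim_inr, RFun.evalQ_mul,
        evalQ_lastS_some, evalQ_eS, evalQ_ebrS, map_mul, add_assoc]
    have hdiv := divided_expand t tT (algebraMap ℚ R (Δ.uq x)) (fun ℓ => algebraMap ℚ R (Δ.lq ℓ x))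
      (fun ℓ => algebraMap ℚ R (Δ.eq ℓ x)) (fun ℓ => algebraMap ℚ R (Δ.e0q ℓ x)) (fun ℓ => algebraMap ℚ R (Δ.ebq ℓ x))
      (fun ℓ => by rw [← map_mul, Δ.uq_mul_ebq ℓ hx', map_sub])
    -- the two commutators vanish
    have h1 := sub_eq_zero.2 (hF x hx)
    rw [comm_Om_OmT] at h1
    have h0 := Δ.flat_closed t tT hF (fz_mem hx' : ∀ i, 0 ≤ fz x i ∧ fz x i ≤ 1)
    rw [comm_Om_OmT] at h0
    simp only [cq_fz, eq_fz, map_zero] at h0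
    simp only [← map_mul, ← Δ.cq_eq_uq_mul_lq] at hdiv
    simp only [map_mul] at hdiv h1
    rw [h1, h0, sub_self] at hdiv
    -- cancel `u ≠ 0`
    have hu : Δ.uq x ≠ 0 := mul_ne_zero hc0.ne' (hx _).1.ne'
    rw [hX]
    have := congrArg (fun b => algebraMap ℚ R (Δ.uq x)⁻¹ • b) hdiv
    simpa only [smul_smul, ← map_mul, inv_mul_cancel₀ hu, map_one, one_smul, smul_zero] using this
  have hk := chi_famTerm_kill hrel (A := A) (n := 0) (fun (q : ℚ) (b : A) => algebraMap_smul R q b) μ₀ B₀ hpt ρ (RFun.const 1) π hπ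
  simp only [chi_famTerm_const_one hrel] at hk
  rw [← hk]
  simp only [hμ₀, hB₀, Fintype.sum_sum_type, Fintype.sum_prod_type, Sum.elim_inl, Sum.elim_inr, add_assoc]
  refine congrArg₂ (· + ·) rfl (congrArg₂ (· + ·) rfl (Finset.sum_congr rfl fun ℓ' _ => Finset.sum_congr rfl fun ℓ _ =>
    congrArg (· • _) (RFun.chi_congr hrel fun e _ => ?_)))
  simp only [RFun.fn_mul, lastMult, fn_scaleFam]
  ring

omit [Module ℚ A] [IsScalarTower ℚ R A] in
/-- **Closedness at residues**: `Σ_a t_a 𝐙[δc_a] = Σ_ℓ t_ℓ 𝐙[θ e_ℓ]`. [folklore] -/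
theorem closed_Z (p : ℕ) (ρ : RFun (m + k)) (π : MvPolynomial (Fin (m + k)) ℚ) (hπ : IsScale π) :
    ∑ a, t a * ZS (χ := χ) Δ.c Δ.hc Δ.d Δ.hd p t none (ρ.mul (Δ.headMultD a π hπ)) π hπ =
      ∑ ℓ, t (some ℓ) * ZS (χ := χ) Δ.c Δ.hc Δ.d Δ.hd p t none (ρ.mul (scaleFam (thetaS (Δ.eS ℓ)) π hπ)) π hπ := by
  rw [Fintype.sum_option]
  have h0 : ZS (χ := χ) Δ.c Δ.hc Δ.d Δ.hd p t none (ρ.mul (Δ.headMultD none π hπ)) π hπ = 0 :=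
    ZS_eq_zero_of_mult hrel Δ.c Δ.hc Δ.d Δ.hd (fun e _ => by
      simp only [headMultD, headSD', Option.elim, RFun.fn_mul, fn_scaleFam, RFun.fn_const]; push_cast; ring) p t none π hπ
  rw [h0, mul_zero, zero_add]
  refine Finset.sum_congr rfl fun ℓ _ => congrArg (t (some ℓ) * ·) (ZS_congr_mult hrel Δ.c Δ.hc Δ.d Δ.hd (fun e he => ?_) p t none π hπ)
  have hw : (Fin.snoc (fun j => e (Fin.castAdd k j)) (aeval e π) : Fin (m + 1) → ℝ) ∈ KZ.cube (m + 1) :=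
    KZ.snoc_mem_cube_iff.2 ⟨fun j => he _, (hπ _ he).1, (hπ _ he).2⟩
  simp only [headMultD, headSD', Option.elim, RFun.fn_mul, fn_scaleFam]
  rw [Δ.fn_headSD_eq_thetaS_eS ℓ hw]

omit [Algebra ℚ R] [Fintype ι] [DecidableEq ι] [Module ℚ A] [IsScalarTower ℚ R A] in
/-- Splitting a multiplier class along a pointwise sum of scale-reading factors. [folklore] -/
theorem chi_mul_scaleFam_of_fn_add (g₁ g₂ g₃ : RFun (m + 1)) (h : ∀ w ∈ KZ.cube (m + 1), g₁.fn w = g₂.fn w + g₃.fn w)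
    (ρ : RFun (m + k)) (π : MvPolynomial (Fin (m + k)) ℚ) (hπ : IsScale π) :
    (ρ.mul (scaleFam g₁ π hπ)).chi χ = (ρ.mul (scaleFam g₂ π hπ)).chi χ + (ρ.mul (scaleFam g₃ π hπ)).chi χ := by
  rw [← RFun.chi_add hrel]
  refine RFun.chi_congr hrel fun e he => ?_
  have hw : (Fin.snoc (fun j => e (Fin.castAdd k j)) (aeval e π) : Fin (m + 1) → ℝ) ∈ KZ.cube (m + 1) :=
    KZ.snoc_mem_cube_iff.2 ⟨fun j => he _, (hπ _ he).1, (hπ _ he).2⟩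
  rw [RFun.fn_add he, RFun.fn_mul, RFun.fn_mul, RFun.fn_mul, fn_scaleFam, fn_scaleFam, fn_scaleFam, h _ hw]
  ring

omit [Module ℚ A] [IsScalarTower ℚ R A] in
/-- **TF-Z, word length one** (no flatness needed). [folklore] -/
theorem tfz_zero : Δ.TFZ (χ := χ) t tT 0 := by
  intro k ρ π hπ
  have hπ' := isScale_scaleMul hπ
  simp only [ZS_zero, mul_zero, zero_mul, sub_self, Finset.sum_const_zero, zero_add, if_true]
  rw [Δ.YS_eq_YDS hrel, Δ.YDS_succ hrel]
  simp only [if_true, ZS_zero, YS_zero, add_zero, zero_mul, sub_zero, Fintype.sum_option]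
  have h0 : (ρ.lift.mul (Δ.lastMultD none (scaleMul π) hπ')).chi χ = 0 :=
    chi_mul_scaleFam_const_zero (m := m) (k := k + 1) hrel ρ.lift (scaleMul π) hπ'
  rw [h0, zero_smul, mul_zero, zero_add]
  refine Finset.sum_congr rfl fun ℓ _ => ?_
  rw [mul_smul_comm, mul_one, chi_mul_scaleFam_S hrel (Δ.ebrS ℓ) ρ π hπ]
  refine congrArg (· • t (some ℓ)) ?_
  exact chi_mul_scaleFam_of_fn_add (m := m) (k := k + 1) hrel (Δ.lastSD ℓ) (Δ.ebrS ℓ) (thetaS (Δ.ebrS ℓ))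
    (fun w hw => Δ.fn_lastSD_eq ℓ hw) ρ.lift (scaleMul π) hπ'

/-- **TF-Z, the core of the induction step** (after the rider Stokes move). [folklore] -/
theorem tfz_core (hc0 : 0 < Δ.c) (hF : Δ.Flat R t tT) (p : ℕ) (ih : Δ.TFZ (χ := χ) t tT p) (ρ : RFun (m + (k + 1)))
    (π : MvPolynomial (Fin (m + (k + 1))) ℚ) (hπ : IsScale π) :
    Δ.YDS (χ := χ) (p + 1 + 1) t ρ π hπ =
      tT * DS (χ := χ) Δ.c Δ.hc Δ.d Δ.hd (p + 1) t none ρ π hπ - DS (χ := χ) Δ.c Δ.hc Δ.d Δ.hd (p + 1) t none ρ π hπ * tT +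
      ∑ ℓ, (t (some ℓ) * (DS (χ := χ) Δ.c Δ.hc Δ.d Δ.hd (p + 1) t none (ρ.mul (scaleFam (Δ.eS ℓ) π hπ)) π hπ +
          ZS (χ := χ) Δ.c Δ.hc Δ.d Δ.hd (p + 1) t none (ρ.mul (scaleFam (thetaS (Δ.eS ℓ)) π hπ)) π hπ) -
        DS (χ := χ) Δ.c Δ.hc Δ.d Δ.hd (p + 1) t none (ρ.mul (scaleFam (Δ.e0S ℓ) π hπ)) π hπ * t (some ℓ)) := by
  unfold TFZ at ih
  rw [Δ.YDS_succ hrel]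
  simp only [if_neg (Nat.succ_ne_zero p), zero_add, ih, DS_succ hrel Δ.c Δ.hc Δ.d Δ.hd none Δ.d_none]
  -- a rider point of the (riders, scale) cube
  have hwpt : ∀ e ∈ KZ.cube (m + (k + 1)),
      (Fin.snoc (fun j => e (Fin.castAdd (k + 1) j)) (aeval e π) : Fin (m + 1) → ℝ) ∈ KZ.cube (m + 1) := fun e he =>
    KZ.snoc_mem_cube_iff.2 ⟨fun j => he _, (hπ _ he).1, (hπ _ he).2⟩
  rcases Nat.eq_zero_or_pos p with rfl | hp
  · simp only [if_true, ZS_zero, mul_zero, zero_mul, sub_self, Finset.sum_const_zero, zero_add]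
    refine tf_step_zero t tT (fun a => ZS (χ := χ) Δ.c Δ.hc Δ.d Δ.hd 1 t none (ρ.mul (Δ.headMultD a π hπ)) π hπ)
      (fun ℓ => ZS (χ := χ) Δ.c Δ.hc Δ.d Δ.hd 1 t none (ρ.mul (scaleFam (thetaS (Δ.eS ℓ)) π hπ)) π hπ)
      (fun a => (ρ.mul (lastMult Δ.c Δ.hc (Δ.d a) (Δ.hd a) π hπ)).chi χ) (ρ.chi χ)
      (fun a ℓ => ((ρ.mul (headMult Δ.c Δ.hc (Δ.d a) (Δ.hd a) π hπ)).mul (scaleFam (Δ.ebrS ℓ) π hπ)).chi χ)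
      (fun ℓ => (ρ.mul (scaleFam (Δ.ebrS ℓ) π hπ)).chi χ) (fun ℓ => (ρ.mul (scaleFam (Δ.eS ℓ) π hπ)).chi χ)
      (fun ℓ => (ρ.mul (scaleFam (Δ.e0S ℓ) π hπ)).chi χ)
      (fun ℓ a => ((ρ.mul (scaleFam (Δ.eS ℓ) π hπ)).mul (lastMult Δ.c Δ.hc (Δ.d a) (Δ.hd a) π hπ)).chi χ)
      (fun ℓ a => ((ρ.mul (scaleFam (Δ.e0S ℓ) π hπ)).mul (lastMult Δ.c Δ.hc (Δ.d a) (Δ.hd a) π hπ)).chi χ)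
      ?_ (fun ℓ => ?_) (fun ℓ => ?_) (fun ℓ => ?_) (fun ℓ' ℓ => ?_) (Δ.closed_Z hrel t 1 ρ π hπ)
      (Δ.junk0_chi hrel t tT hc0 hF ρ π hπ)
    · exact chi_mul_lastMult_inv hrel Δ.c Δ.hc Δ.d Δ.hd ρ π hπ Δ.d_none
    · exact chi_mul_lastMult_inv hrel Δ.c Δ.hc Δ.d Δ.hd _ π hπ Δ.d_none
    · exact chi_mul_lastMult_inv hrel Δ.c Δ.hc Δ.d Δ.hd _ π hπ Δ.d_none
    · exact RFun.chi_congr hrel fun e _ => by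
        simp only [RFun.fn_mul, headMult, fn_scaleFam, fn_headS_none, mul_one]
    · rw [← RFun.chi_add hrel]
      refine RFun.chi_congr hrel fun e he => ?_
      rw [RFun.fn_add he]
      simp only [RFun.fn_mul, headMult, lastMult, fn_scaleFam]
      have := Δ.fn_rel1 ℓ' ℓ (hwpt e he)
      linear_combination (ρ.fn e) * this
  · have hp' : p ≠ 0 := hp.ne'
    simp only [if_neg hp', add_zero]
    refine tf_step_generic t tT (fun a => ZS (χ := χ) Δ.c Δ.hc Δ.d Δ.hd p t none (ρ.mul (headMult Δ.c Δ.hc (Δ.d a) (Δ.hd a) π hπ)) π hπ)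
      (fun a => ZS (χ := χ) Δ.c Δ.hc Δ.d Δ.hd (p + 1) t none (ρ.mul (Δ.headMultD a π hπ)) π hπ)
      (fun a ℓ => ZS (χ := χ) Δ.c Δ.hc Δ.d Δ.hd p t none
        ((ρ.mul (headMult Δ.c Δ.hc (Δ.d a) (Δ.hd a) π hπ)).mul (scaleFam (Δ.eS ℓ) π hπ)) π hπ)
      (fun a ℓ => ZS (χ := χ) Δ.c Δ.hc Δ.d Δ.hd p t none
        ((ρ.mul (headMult Δ.c Δ.hc (Δ.d a) (Δ.hd a) π hπ)).mul (scaleFam (Δ.e0S ℓ) π hπ)) π hπ)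
      (fun ℓ a => ZS (χ := χ) Δ.c Δ.hc Δ.d Δ.hd p t none
        ((ρ.mul (scaleFam (Δ.eS ℓ) π hπ)).mul (headMult Δ.c Δ.hc (Δ.d a) (Δ.hd a) π hπ)) π hπ)
      (fun ℓ a => ZS (χ := χ) Δ.c Δ.hc Δ.d Δ.hd p t none
        ((ρ.mul (scaleFam (Δ.e0S ℓ) π hπ)).mul (headMult Δ.c Δ.hc (Δ.d a) (Δ.hd a) π hπ)) π hπ)
      (ZS (χ := χ) Δ.c Δ.hc Δ.d Δ.hd p t none ρ π hπ)
      (fun ℓ => ZS (χ := χ) Δ.c Δ.hc Δ.d Δ.hd p t none (ρ.mul (scaleFam (Δ.eS ℓ) π hπ)) π hπ)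
      (fun ℓ => ZS (χ := χ) Δ.c Δ.hc Δ.d Δ.hd p t none (ρ.mul (scaleFam (Δ.e0S ℓ) π hπ)) π hπ)
      (fun ℓ => ZS (χ := χ) Δ.c Δ.hc Δ.d Δ.hd (p + 1) t none (ρ.mul (scaleFam (thetaS (Δ.eS ℓ)) π hπ)) π hπ)
      (fun ℓ a => ?_) (fun ℓ a => ?_) (Δ.closed_Z hrel t (p + 1) ρ π hπ) (Δ.junk1_Z hrel t tT hF p ρ π hπ)
      (Δ.junk2_Z hrel t tT hF p ρ π hπ)
    · exact ZS_congr_mult hrel Δ.c Δ.hc Δ.d Δ.hd (fun e _ => by simp only [RFun.fn_mul]; ring) p t none π hπ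
    · exact ZS_congr_mult hrel Δ.c Δ.hc Δ.d Δ.hd (fun e _ => by simp only [RFun.fn_mul]; ring) p t none π hπ

/-- **TF-Z, the induction step.** [folklore] -/
theorem tfz_succ (hc0 : 0 < Δ.c) (hF : Δ.Flat R t tT) (p : ℕ) (ih : Δ.TFZ (χ := χ) t tT p) :
    Δ.TFZ (χ := χ) t tT (p + 1) := by
  intro k ρ π hπ
  have hπ' := isScale_scaleMul hπ
  rw [if_neg (Nat.succ_ne_zero p), add_zero, Δ.YS_eq_YDS hrel, ZS_eq_DS hrel]
  have hsum : ∀ ℓ, t (some ℓ) * ZS (χ := χ) Δ.c Δ.hc Δ.d Δ.hd (p + 1) t none (ρ.mul (scaleFam (Δ.eS ℓ) π hπ)) π hπ -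
      ZS (χ := χ) Δ.c Δ.hc Δ.d Δ.hd (p + 1) t none (ρ.mul (scaleFam (Δ.e0S ℓ) π hπ)) π hπ * t (some ℓ) =
      t (some ℓ) * (DS (χ := χ) Δ.c Δ.hc Δ.d Δ.hd (p + 1) t none (k := k + 1)
          (ρ.lift.mul (scaleFam (m := m) (k := k + 1) (Δ.eS ℓ) (scaleMul π) hπ')) (scaleMul π) hπ' +
        ZS (χ := χ) Δ.c Δ.hc Δ.d Δ.hd (p + 1) t none (k := k + 1)
          (ρ.lift.mul (scaleFam (m := m) (k := k + 1) (thetaS (Δ.eS ℓ)) (scaleMul π) hπ')) (scaleMul π) hπ') -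
      DS (χ := χ) Δ.c Δ.hc Δ.d Δ.hd (p + 1) t none (k := k + 1)
          (ρ.lift.mul (scaleFam (m := m) (k := k + 1) (Δ.e0S ℓ) (scaleMul π) hπ')) (scaleMul π) hπ' * t (some ℓ) := by
    intro ℓ
    rw [ZS_mul_scaleFam_S hrel Δ.c Δ.hc Δ.d Δ.hd (Δ.eS ℓ), ZS_mul_scaleFam_S hrel Δ.c Δ.hc Δ.d Δ.hd (Δ.e0S ℓ),
      ZS_eq_zero_of_mult hrel Δ.c Δ.hc Δ.d Δ.hd
        (ρ₁ := ρ.lift.mul (scaleFam (m := m) (k := k + 1) (thetaS (Δ.e0S ℓ)) (scaleMul π) hπ')) (fun e he => by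
          rw [RFun.fn_mul, fn_scaleFam, Δ.fn_thetaS_e0S ℓ (KZ.snoc_mem_cube_iff.2 ⟨fun j => he _, (hπ' _ he).1,
            (hπ' _ he).2⟩), mul_zero]) (p + 1) t none (scaleMul π) hπ', add_zero]
  simp only [hsum]
  exact Δ.tfz_core hrel t tT hc0 hF p ih (k := k) ρ.lift (scaleMul π) hπ'

/-- **Transverse flatness of the regularised transport** (TF-Z, all degrees): for a chart direction
with transverse derivative data, flat (`[uΩ_u, pΩ_p] = 0` on the open box), the transverse derivative
of the regularised `Z`-series is `δ𝐙 = [t_⊥, 𝐙] + Σ_ℓ (e_ℓ t_ℓ 𝐙 − 𝐙 t_ℓ e⁰_ℓ) + Σ_ℓ ĕ_ℓ t_ℓ`, degree by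
degree at the residues. [cite: IharaKanekoZagier2006, §3] -/
theorem tfz (hc0 : 0 < Δ.c) (hF : Δ.Flat R t tT) : ∀ n, Δ.TFZ (χ := χ) t tT n
  | 0 => Δ.tfz_zero hrel t tT
  | p + 1 => Δ.tfz_succ hrel t tT hc0 hF p (tfz hc0 hF p)

end DirData

end TFZ

end Literature.NumberTheory.Transcendental.KZ.Cube
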